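import Literature.MathematicalPhysics.QuantumFieldTheory.Balaban1983to89.Node00.OpsYRecordV10
import Literature.MathematicalPhysics.QuantumFieldTheory.Balaban1983to89.Node00.OpsYIds3152ReductionQ
import Literature.MathematicalPhysics.QuantumFieldTheory.Balaban1983to89.B9B8KnitLetterGpDecay
import Literature.MathematicalPhysics.QuantumFieldTheory.Balaban1983to89.B9B8KnitLetterProjectionC

/-!
# def-Y's KNIT-KEYED OPERATOR LAYER OF RECORD (v11): the covariant letters over PRINT's site transporter `parKnitY` ([Balaban1985Averaging] Prop. 2),
# the v11 star instances `opsYStOfRecordV11E ∕ opsYNuStOfRecordV11E` over an averaging pair, their KNIT-PAIR instances `…V11KE`, and (3.152) ∕ (3.124)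
# for the record's own `G₁` — Balaban, Commun. Math. Phys. **99** (1985) 389–434, (3.19)–(3.27) pp.393–395, (3.115) p.418, (3.122)–(3.153) pp.420–426

[cite: Balaban1985BackgroundPropagators, (3.19) p.393, (3.24)–(3.27) pp.394–395, (3.35) p.396, (3.48) p.398, (3.115) p.418, (3.122)–(3.132) pp.420–422,
(3.138) p.423, (3.147)–(3.153) pp.425–426, (3.154) p.427, (3.156)–(3.158) p.428, Thm 3.15 (3.185)–(3.187) p.432; p.395 + Cor. 3.5 p.407 (U = 1 clauses)]
[cite: Balaban1985Averaging, Prop. 2 p.26, (15)–(23) pp.19–21, (52)–(53) p.26]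

The landed v10 record (`Node00.OpsYSectDQ.covLettersY_v10`, `Node00.OpsYRecordV10`) rebuilds the nine `Q`-dependent letters over a generic averaging pair
`(𝔮, 𝔮⋆)` but inherits def-Y's v4 BASE CHAIN, whose site transporter is the symmetrised `parSymY` (`covLettersY_v10_parS`).  dag-n06-l's suppliers of the
load-bearing N06 rows — the (3.24)–(3.25) `R`-identities `B9Eq325RIdentitiesKnitPairY`, the symmetry of `R` `B9B8KnitLetterProjectionC`, `Δ′_a`'s reality ∕
symmetry `B9B8KnitLetterGpDecay`, and (3.115)'s consequence `Q D G′ R = 0` on (3.35) `B9Eq3124HZKnitPairReg335Y` — are all keyed at PRINT's site transporter,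
the KNIT letter `parKnitY` (products of the averaged contour variables `Ū^j(Γ)`, [Balaban1985Averaging] (52)–(53)); dag-n06-l answered def-Y's keying
question Q5 (fleet bus 2026-08-30) with «option (b): the instance at `parS := parKnitY` under ONE binder list».  This file is that instance:

* §1 the KNIT-KEYED BASE CHAIN at a member, over any coefficient algebra: `CovLettersY.withTransportK` (`parS := parKnitY`, `parB := parBY`; the printed
  `U = 1` clauses by `parKnitY_one ∕ parBY_one`), `covLettersY_TGpK = withGp ∘ withTransportK ∘ flat` (`G′ = (Δ′_a)⁻¹` over the knit transporter),
  `covLettersY_v2K = withGAC ∘ …` (`G = Δ_a⁻¹`, `C = (Q′G′²Q′*)⁻¹`), and ★★★ `covLettersY_v11 := (covLettersY_v2K).withQ 𝔮 𝔮⋆ h𝔮 h𝔮⋆ (parKnitY x.snd)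
  (GpY x.snd (parKnitY x.snd)) (GpPhysY x (parKnitY x)) 𝔯.Δ2` — the nine `Q`-dependent letters over the pair, the seven Sect. D∕E composites fed the
  print-units site propagator `G′_phys` over the KNIT transporter; every letter by name (`rfl` faces);
* §2 at an index over `M_N(ℂ)`: the table inputs at `parKnitY` DISCHARGED — `G′_phys`, `R` symmetric at a `G`-valued background with `G`-valued knit legs
  (`isSymmTr_GpPhysY_parKnitY`, `RY_GpPhysY_parKnitY_isSymmTr`, from dag-n06-l's `symm0_parKnitY`, `RY_parKnitY_isSymmTr`), hence `G̃[𝔮] ∕ G₁[𝔮] ∕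
  (𝔮G₁𝔮⋆)⁻¹ ∕ 𝔊[𝔮]` fed `G′_phys (parKnitY)` symmetric for an adjoint pair, and the unit `(𝔮G₁𝔮⋆)(U)` from `Δ⁽¹⁾(U) > 0`;
* §3 ★★★ the v11 LETTERS OF RECORD `lettersYOfRecordV11 N θ Mstar 𝔮 𝔮⋆ h𝔮 h𝔮⋆ 𝔯` and the two STAR INSTANCES `opsYStOfRecordV11E ∕ opsYNuStOfRecordV11E`
  (`opsYSectESt ∘ opsYS349[Nu]OfLetters`, exactly the v10 constructors) with the faces a certificate elaborates against: base rows, the Sect. B∕D∕E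
  composites by name, `hsymD`, `hUQ`, rows 17–26 unfolded (`rfl`), row 24 (`t315`) unfolded ∕ honesty guard ∕ KEYED to the v7 star Sect.-E record;
* §4 ★★★ the KNIT-PAIR instances of record `lettersYOfRecordV11K ∕ opsYStOfRecordV11KE ∕ opsYNuStOfRecordV11KE` at `(qKnitOfRecord, qsKnitOfRecord)` =
  print's `Q` of (3.115) with its trace adjoint, over print's transporter — BOTH print-faithful choices at once — with their faces; `GD` symmetric on the
  regime of record OUTRIGHT (`lettersYOfRecordV11K_GD_isSymmTr_of_regQY`);
* §5 ★★★ THE PAYOFF: (3.152) `R D* G₁ = R G′ D*`, `G₁ D R = D G′ R` and (3.124) `Q G₁ D R = 0`, `R D* G₁ Q† = 0`, `R D* G₁ D R = R` FOR THE v11 KNIT RECORD'S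
  OWN LETTER `G₁ = (lettersYOfRecordV11K … x).G₁` at every background of the regime of record, given ONLY the invertibility of `G₁⁻¹(U)` ((3.138), not
  claimed) — `Node00.OpsYIds3152ReductionQ.ids3152Q_qKnitOfRecord_of_regQY` read on the record (`lettersYOfRecordV11K_ids3152_of_regQY`).

HONEST STATUS.  Typing and bookkeeping over landed mathematics; no estimate of [B9] is asserted; (3.138) enters only as the hypothesis `hM1 ∕ hΔ1`; the
`G`-valuedness of the knit legs is the displayed hypothesis `hpar` off the regime of record and dag-n06-l's theorem on it.  0 `sorry`.
-/

namespace Literature.MathematicalPhysics.QuantumFieldTheory.Balaban1983to89.Node00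

open B6KLevelCensusIndexV1 (KIdx kGeo)
open B9PinMembersKLevelV1 (MemberY geo9Y bg9Y)
open B9PinCarriersKLevelV1 (carriersY)
open B9PinGeometryKLevelV1 (inΛY unitDistY c35Y)
open B9BackgroundsKLevelV1R (RegFamY bg9YR siteKernelR MemOfFam)
open B7Prop2SpecialUnitary (specialUnitaryUnits specialUnitaryUnits_le_unitaryUnits)
open B7Prop2Explicit (C0 c2')
open B9C2FormBoxRegimeY (Kpl)
open B9Thm311ReadingCoords (IsSymmTr IsAdjTr PosDefTr)
open B9Thm311AdjointPairs (GpY_isSymmTr)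
open B9B8AveragingJunction (parKnitY parKnitY_one)
open B9B8KnitLetterGpDecay (symm0_parKnitY)
open B9B8KnitLetterProjectionC (RY_parKnitY_isSymmTr)
open B9Ineq349SiteReading (p349SiteY fineKernelOfSiteOp opsYS349OfLetters)
open B9Eq3132NuReading (siteKernelOfOpNu nuY opsYS349NuOfLetters)
open B9Thm315SectEStarRepAtLettersR (DecayMidOnStY t315_opsYSectESt_sectEStYOfRecordV7_of_3185_on
  t315_opsYSectESt_sectEStYOfRecordV7_of_3185_onR)
open OpsYQLetter (QLetterY QsLetterY RegimeY QFamY QsFamY IsOntoOnQ regQY mem_of_regQY parKnitY_mem_unitary_of_regQY qKnitOfRecord qsKnitOfRecord)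
open scoped Matrix

noncomputable section

variable {d ℓ : ℕ} {hd : 1 ≤ d + 1} {hL : Odd (ℓ + 1) ∧ 1 < ℓ + 1} {b₀ b₁ : ℝ} {Mstar : ℕ}

/-! ## §1 The knit-keyed base chain at a member: `withTransportK`, `covLettersY_TGpK`, `covLettersY_v2K`, ★★★ `covLettersY_v11` -/

section Chain

variable {𝔸 : Type} [NormedRing 𝔸] [NormedAlgebra ℂ 𝔸] [CompleteSpace 𝔸]
variable (𝔸) {x : MemberY d ℓ hd hL b₀ b₁ Mstar}

/-- ★ the UPGRADE of a letter family to PRINT's KNIT site transporter `parKnitY` ([Balaban1985Averaging] Prop. 2: the contour variables `U(Γ)` of (3.19) are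
products of the averaged fields `Ū^j`), bond transporter the taxicab `parBY`; the printed `U = 1` clauses by `parKnitY_one ∕ parBY_one`.
[cite: Balaban1985BackgroundPropagators, (3.19) p.393, (3.24) p.394, (3.40) p.397, p.395 (U = 1)] [cite: Balaban1985Averaging, Prop. 2 p.26, (52)–(53) p.26] -/
def CovLettersY.withTransportK (𝔏 : CovLettersY 𝔸 x) : CovLettersY 𝔸 x :=
  { 𝔏 with
    parS := parKnitY x.toKIdx
    parB := parBY x.toKIdx
    parS_one := fun z z' => parKnitY_one x.toKIdx z z'
    parB_one := fun s s' => parBY_one x.toKIdx s s' }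

variable {𝔸}
variable (𝔏 : CovLettersY 𝔸 x)

/-- the upgraded site transporter is the knit letter. [cite: Balaban1985BackgroundPropagators, (3.19) p.393, bookkeeping] -/
theorem CovLettersY.withTransportK_parS : (𝔏.withTransportK 𝔸).parS = parKnitY x.toKIdx := rfl
/-- the upgraded bond transporter is the taxicab one. [cite: Balaban1985BackgroundPropagators, (3.40) p.397, bookkeeping] -/
theorem CovLettersY.withTransportK_parB : (𝔏.withTransportK 𝔸).parB = parBY x.toKIdx := rfl
/-- the upgrade keeps `G′`. [cite: Balaban1985BackgroundPropagators, (3.25) p.394, bookkeeping] -/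
theorem CovLettersY.withTransportK_Gp : (𝔏.withTransportK 𝔸).Gp = 𝔏.Gp := rfl
/-- the upgrade keeps `G`. [cite: Balaban1985BackgroundPropagators, (3.27) p.395, bookkeeping] -/
theorem CovLettersY.withTransportK_GA : (𝔏.withTransportK 𝔸).GA = 𝔏.GA := rfl
/-- the upgrade keeps `C`. [cite: Balaban1985BackgroundPropagators, (3.48) p.398, bookkeeping] -/
theorem CovLettersY.withTransportK_C : (𝔏.withTransportK 𝔸).C = 𝔏.C := rfl

variable (𝔸) (x : MemberY d ℓ hd hL b₀ b₁ Mstar)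

/-- the flat family with KNIT transporters and the genuine `G′ = (Δ′_a)⁻¹` over them. [cite: Balaban1985BackgroundPropagators, (3.24)–(3.25) pp.394–395] -/
def covLettersY_TGpK : CovLettersY 𝔸 x := ((covLettersY_flat 𝔸 x).withTransportK 𝔸).withGp 𝔸

/-- ★ **def-Y's v2K family**: knit transporters, genuine `G′ = Δ′_a⁻¹`, `G = Δ_a⁻¹`, `C = (Q′G′²Q′*)⁻¹` (`withGAC`).
[cite: Balaban1985BackgroundPropagators, (3.25)–(3.27) p.395, (3.48) p.398] -/
def covLettersY_v2K : CovLettersY 𝔸 x := (covLettersY_TGpK 𝔸 x).withGAC 𝔸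

/-- its site transporter is the knit letter. [cite: Balaban1985BackgroundPropagators, (3.19) p.393, bookkeeping] -/
theorem covLettersY_v2K_parS : (covLettersY_v2K 𝔸 x).parS = parKnitY x.toKIdx := rfl
/-- its bond transporter is the taxicab one. [cite: Balaban1985BackgroundPropagators, (3.40) p.397, bookkeeping] -/
theorem covLettersY_v2K_parB : (covLettersY_v2K 𝔸 x).parB = parBY x.toKIdx := rfl
/-- its `G′`. [cite: Balaban1985BackgroundPropagators, (3.25) p.395, bookkeeping] -/
theorem covLettersY_v2K_Gp : (covLettersY_v2K 𝔸 x).Gp = GpY x.toKIdx (parKnitY x.toKIdx) := rfl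
/-- its `G = Δ_a⁻¹`. [cite: Balaban1985BackgroundPropagators, (3.27) p.395, bookkeeping] -/
theorem covLettersY_v2K_GA :
    (covLettersY_v2K 𝔸 x).GA = GAY x.toKIdx (parKnitY x.toKIdx) (parBY x.toKIdx) (GpY x.toKIdx (parKnitY x.toKIdx)) := rfl
/-- its `C = (Q′G′²Q′*)⁻¹`. [cite: Balaban1985BackgroundPropagators, (3.48) p.398, bookkeeping] -/
theorem covLettersY_v2K_C : (covLettersY_v2K 𝔸 x).C = CY x.toKIdx (parKnitY x.toKIdx) (GpY x.toKIdx (parKnitY x.toKIdx)) := rfl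
/-- the PINS of the v2K family. [cite: Balaban1985BackgroundPropagators, (3.25)–(3.27) p.395, (3.48) p.398, bookkeeping] -/
theorem covLettersY_v2K_pins :
    (covLettersY_v2K 𝔸 x).Gp = GpY x.toKIdx (covLettersY_v2K 𝔸 x).parS ∧
      (covLettersY_v2K 𝔸 x).GA = GAY x.toKIdx (covLettersY_v2K 𝔸 x).parS (covLettersY_v2K 𝔸 x).parB (covLettersY_v2K 𝔸 x).Gp ∧
      (covLettersY_v2K 𝔸 x).C = CY x.toKIdx (covLettersY_v2K 𝔸 x).parS (covLettersY_v2K 𝔸 x).Gp := ⟨rfl, rfl, rfl⟩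

/-- ★★★ **def-Y's v11 FAMILY AT A MEMBER**: the v2K family (KNIT transporters `parKnitY ∕ parBY`, `G′ = GpY (parKnitY)`, `C`, printed `U = 1` clauses) with
its NINE `Q`-dependent letters rebuilt over the pair family `(𝔮, 𝔮⋆)` — `GA = G[𝔮 x](U)` at lattice units, `Kdiff = G[𝔮 x](Ω,U) − G[𝔮 x.snd](Ω′,U)`
(second sequence at `parKnitY ∕ GpY` of `x.snd`), and the seven Sect. D∕E composites fed the print-units site propagator `G′_phys = GpPhysY (parKnitY)`
over the residual letter `𝔯.Δ2` — the constructor of `covLettersY_v10` over the knit-keyed base chain.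
[cite: Balaban1985BackgroundPropagators, (3.26)–(3.27) p.395, (3.115) p.418, (3.122)–(3.132) pp.420–422, (3.153)–(3.154) pp.426–427] [cite: Balaban1985Averaging, Prop. 2 p.26] -/
def covLettersY_v11 (𝔮 : ∀ i : KIdx d ℓ hd hL b₀ b₁, CfgY 𝔸 i → ((FBondY i → 𝔸) →ₗ[ℂ] (IBondY i → 𝔸)))
    (𝔮s : ∀ i : KIdx d ℓ hd hL b₀ b₁, CfgY 𝔸 i → ((IBondY i → 𝔸) →ₗ[ℂ] (FBondY i → 𝔸)))
    (h𝔮 : 𝔮 x.toKIdx (fun _ _ => 1) = liftMatY 𝔸 (qK x.toKIdx)) (h𝔮s : 𝔮s x.toKIdx (fun _ _ => 1) = liftMatY 𝔸 (qsK x.toKIdx))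
    (𝔯 : ResLettersY 𝔸 x) : CovLettersY 𝔸 x :=
  (covLettersY_v2K 𝔸 x).withQ 𝔸 𝔮 𝔮s h𝔮 h𝔮s (parKnitY x.snd) (GpY x.snd (parKnitY x.snd)) (GpPhysY x.toKIdx (parKnitY x.toKIdx)) 𝔯.Δ2

variable {x}
variable (𝔮 : ∀ i : KIdx d ℓ hd hL b₀ b₁, CfgY 𝔸 i → ((FBondY i → 𝔸) →ₗ[ℂ] (IBondY i → 𝔸)))
  (𝔮s : ∀ i : KIdx d ℓ hd hL b₀ b₁, CfgY 𝔸 i → ((IBondY i → 𝔸) →ₗ[ℂ] (FBondY i → 𝔸)))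
  (h𝔮 : 𝔮 x.toKIdx (fun _ _ => 1) = liftMatY 𝔸 (qK x.toKIdx)) (h𝔮s : 𝔮s x.toKIdx (fun _ _ => 1) = liftMatY 𝔸 (qsK x.toKIdx))
  (𝔯 : ResLettersY 𝔸 x)

/-- its `GA = G[𝔮 x]` at lattice units over the knit transporter. [cite: Balaban1985BackgroundPropagators, (3.27) p.395, bookkeeping] -/
theorem covLettersY_v11_GA : (covLettersY_v11 𝔸 x 𝔮 𝔮s h𝔮 h𝔮s 𝔯).GA =
    GAQY x.toKIdx (𝔮 x.toKIdx) (𝔮s x.toKIdx) (parKnitY x.toKIdx) (GpY x.toKIdx (parKnitY x.toKIdx)) := rfl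
/-- its `Kdiff = G[𝔮 x](Ω) − G[𝔮 x.snd](Ω′)`. [cite: Balaban1985BackgroundPropagators, (3.154) p.427, bookkeeping] -/
theorem covLettersY_v11_Kdiff : (covLettersY_v11 𝔸 x 𝔮 𝔮s h𝔮 h𝔮s 𝔯).Kdiff = fun U =>
    GAQY x.toKIdx (𝔮 x.toKIdx) (𝔮s x.toKIdx) (parKnitY x.toKIdx) (GpY x.toKIdx (parKnitY x.toKIdx)) U
      - GAsndQY 𝔸 x 𝔮 𝔮s (parKnitY x.snd) (GpY x.snd (parKnitY x.snd)) U := rfl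
/-- its `H = H[𝔮 x]` fed `G′_phys`. [cite: Balaban1985BackgroundPropagators, (3.126) p.420, bookkeeping] -/
theorem covLettersY_v11_H : (covLettersY_v11 𝔸 x 𝔮 𝔮s h𝔮 h𝔮s 𝔯).H =
    HDQY x.toKIdx (𝔮 x.toKIdx) (𝔮s x.toKIdx) (parKnitY x.toKIdx) (GpPhysY x.toKIdx (parKnitY x.toKIdx)) := rfl
/-- its `QGQinv = (𝔮G̃𝔮⋆)⁻¹` fed `G′_phys`. [cite: Balaban1985BackgroundPropagators, (3.132) p.422, bookkeeping] -/
theorem covLettersY_v11_QGQinv : (covLettersY_v11 𝔸 x 𝔮 𝔮s h𝔮 h𝔮s 𝔯).QGQinv =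
    QGQinvQY x.toKIdx (𝔮 x.toKIdx) (𝔮s x.toKIdx) (parKnitY x.toKIdx) (GpPhysY x.toKIdx (parKnitY x.toKIdx)) := rfl
/-- its `GD = G̃[𝔮 x]` fed `G′_phys`. [cite: Balaban1985BackgroundPropagators, (3.122) p.420, bookkeeping] -/
theorem covLettersY_v11_GD : (covLettersY_v11 𝔸 x 𝔮 𝔮s h𝔮 h𝔮s 𝔯).GD =
    GDQY x.toKIdx (𝔮 x.toKIdx) (𝔮s x.toKIdx) (parKnitY x.toKIdx) (GpPhysY x.toKIdx (parKnitY x.toKIdx)) := rfl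
/-- its `G₁ = G₁[𝔮 x]` fed `G′_phys` over `𝔯.Δ2`. [cite: Balaban1985BackgroundPropagators, (3.128)–(3.129) p.421, bookkeeping] -/
theorem covLettersY_v11_G₁ : (covLettersY_v11 𝔸 x 𝔮 𝔮s h𝔮 h𝔮s 𝔯).G₁ =
    G1QY x.toKIdx (𝔮 x.toKIdx) (𝔮s x.toKIdx) (parKnitY x.toKIdx) (GpPhysY x.toKIdx (parKnitY x.toKIdx)) 𝔯.Δ2 := rfl
/-- its `QG1Qinv = (𝔮G₁𝔮⋆)⁻¹`. [cite: Balaban1985BackgroundPropagators, (3.132) p.422, bookkeeping] -/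
theorem covLettersY_v11_QG1Qinv : (covLettersY_v11 𝔸 x 𝔮 𝔮s h𝔮 h𝔮s 𝔯).QG1Qinv =
    QG1QinvQY x.toKIdx (𝔮 x.toKIdx) (𝔮s x.toKIdx) (parKnitY x.toKIdx) (GpPhysY x.toKIdx (parKnitY x.toKIdx)) 𝔯.Δ2 := rfl
/-- its `H₁ = H₁[𝔮 x]`. [cite: Balaban1985BackgroundPropagators, (3.129) p.421, bookkeeping] -/
theorem covLettersY_v11_H₁ : (covLettersY_v11 𝔸 x 𝔮 𝔮s h𝔮 h𝔮s 𝔯).H₁ =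
    H1QY x.toKIdx (𝔮 x.toKIdx) (𝔮s x.toKIdx) (parKnitY x.toKIdx) (GpPhysY x.toKIdx (parKnitY x.toKIdx)) 𝔯.Δ2 := rfl
/-- its `GG = 𝔊[𝔮 x]`. [cite: Balaban1985BackgroundPropagators, (3.153) p.426, bookkeeping] -/
theorem covLettersY_v11_GG : (covLettersY_v11 𝔸 x 𝔮 𝔮s h𝔮 h𝔮s 𝔯).GG =
    GGQY x.toKIdx (𝔮 x.toKIdx) (𝔮s x.toKIdx) (parKnitY x.toKIdx) (GpPhysY x.toKIdx (parKnitY x.toKIdx)) 𝔯.Δ2 := rfl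
/-- its site transporter is the knit letter. [cite: Balaban1985BackgroundPropagators, (3.19) p.393, bookkeeping] [cite: Balaban1985Averaging, Prop. 2 p.26] -/
theorem covLettersY_v11_parS : (covLettersY_v11 𝔸 x 𝔮 𝔮s h𝔮 h𝔮s 𝔯).parS = parKnitY x.toKIdx := rfl
/-- its bond transporter (kernel readers) is the taxicab one. [cite: Balaban1985BackgroundPropagators, (3.40) p.397, bookkeeping] -/
theorem covLettersY_v11_parB : (covLettersY_v11 𝔸 x 𝔮 𝔮s h𝔮 h𝔮s 𝔯).parB = parBY x.toKIdx := rfl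
/-- its `G′` is `GpY (parKnitY)` (lattice units). [cite: Balaban1985BackgroundPropagators, (3.25) p.395, bookkeeping] -/
theorem covLettersY_v11_Gp : (covLettersY_v11 𝔸 x 𝔮 𝔮s h𝔮 h𝔮s 𝔯).Gp = GpY x.toKIdx (parKnitY x.toKIdx) := rfl
/-- its `C = (Q′G′²Q′*)⁻¹` over the knit transporter. [cite: Balaban1985BackgroundPropagators, (3.48) p.398, bookkeeping] -/
theorem covLettersY_v11_C : (covLettersY_v11 𝔸 x 𝔮 𝔮s h𝔮 h𝔮s 𝔯).C = CY x.toKIdx (parKnitY x.toKIdx) (GpY x.toKIdx (parKnitY x.toKIdx)) := rfl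
/-- its `P349 ∕ Ck` slots are the flat record's pins. [cite: Balaban1985BackgroundPropagators, (3.49) p.399, (3.187) p.432, bookkeeping] -/
theorem covLettersY_v11_P349_Ck : (covLettersY_v11 𝔸 x 𝔮 𝔮s h𝔮 h𝔮s 𝔯).P349 = (covLettersY_flat 𝔸 x).P349 ∧
    (covLettersY_v11 𝔸 x 𝔮 𝔮s h𝔮 h𝔮s 𝔯).Ck = (covLettersY_flat 𝔸 x).Ck := ⟨rfl, rfl⟩

end Chain

/-! ## §2 At an index over `M_N(ℂ)`: the table inputs at `parKnitY ∕ GpPhysY (parKnitY)` discharged; the `Q`-dependent composites symmetric; the unit `(𝔮G₁𝔮⋆)` -/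

section SymmK

open scoped Matrix.Norms.L2Operator

variable {N : ℕ} (i : KIdx d ℓ hd hL b₀ b₁) {G : Subgroup (Matrix (Fin N) (Fin N) ℂ)ˣ}

/-- ★ `G′_phys(U) = η²(Δ′_a)⁻¹` OVER THE KNIT TRANSPORTER IS SYMMETRIC at a `G`-valued background with `G`-valued knit legs, `G ≤ U(N)` (dag-n06-l's `symm0_parKnitY`).
[cite: Balaban1985BackgroundPropagators, (3.24)–(3.25) p.394] [cite: Balaban1985Averaging, Prop. 2 p.26] -/
theorem isSymmTr_GpPhysY_parKnitY (hG : G ≤ B7Prop2Explicit.unitaryUnits (Matrix (Fin N) (Fin N) ℂ)) {U : CfgY (Matrix (Fin N) (Fin N) ℂ) i}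
    (hU : ∀ μ x, U μ x ∈ G) (hpar : ∀ z w : SiteY i, parKnitY i U z w ∈ G) : IsSymmTr (fun _ => (1 : ℝ)) (GpPhysY i (parKnitY i) U) := by
  rw [GpPhysY_apply]
  exact isSymmTr_coe_real_smul _ _ (GpY_isSymmTr i (parKnitY i) U (symm0_parKnitY i hG hU hpar))

/-- ★ `R(U)` (3.25) over the knit transporter and `G′_phys` IS SYMMETRIC at a `G`-valued background with `G`-valued knit legs (dag-n06-l's `RY_parKnitY_isSymmTr`).
[cite: Balaban1985BackgroundPropagators, (3.25) p.394] [cite: Balaban1985Averaging, Prop. 2 p.26] -/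
theorem RY_GpPhysY_parKnitY_isSymmTr (hG : G ≤ B7Prop2Explicit.unitaryUnits (Matrix (Fin N) (Fin N) ℂ)) {U : CfgY (Matrix (Fin N) (Fin N) ℂ) i}
    (hU : ∀ μ x, U μ x ∈ G) (hpar : ∀ z w : SiteY i, parKnitY i U z w ∈ G) :
    IsSymmTr (fun _ => (1 : ℝ)) (RY i (parKnitY i) (GpPhysY i (parKnitY i)) U) := by
  rw [RY_GpPhysY]
  exact RY_parKnitY_isSymmTr i hG hU hpar

variable (𝔮 : QLetterY (Matrix (Fin N) (Fin N) ℂ) i) (𝔮s : QsLetterY (Matrix (Fin N) (Fin N) ℂ) i)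

/-- ★★ `G̃[𝔮](U)` FED `G′_phys` OVER THE KNIT TRANSPORTER IS SYMMETRIC at a `G`-valued background with `G`-valued knit legs, for an adjoint pair.
[cite: Balaban1985BackgroundPropagators, (3.122)–(3.123) p.420, (3.24)–(3.25) p.394] [cite: Balaban1985Averaging, Prop. 2 p.26] -/
theorem GDQY_GpPhysY_isSymmTr_parKnitY (hG : G ≤ B7Prop2Explicit.unitaryUnits (Matrix (Fin N) (Fin N) ℂ)) {U : CfgY (Matrix (Fin N) (Fin N) ℂ) i}
    (hU : ∀ μ x, U μ x ∈ G) (hpar : ∀ z w : SiteY i, parKnitY i U z w ∈ G) (hQ : IsAdjTr (fun _ => (1 : ℝ)) (fun _ => (1 : ℝ)) (𝔮 U) (𝔮s U)) :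
    IsSymmTr (fun _ => (1 : ℝ)) (GDQY i 𝔮 𝔮s (parKnitY i) (GpPhysY i (parKnitY i)) U) :=
  GDQY_isSymmTr i 𝔮 𝔮s (parKnitY i) (GpPhysY i (parKnitY i)) U hG hU hQ (isSymmTr_GpPhysY_parKnitY i hG hU hpar)
    (RY_GpPhysY_parKnitY_isSymmTr i hG hU hpar)

/-- ★★ `G₁[𝔮](U)` fed `G′_phys` over the knit transporter IS SYMMETRIC at such data, for an adjoint pair and symmetric `Δ⁽²⁾(U)`.
[cite: Balaban1985BackgroundPropagators, (3.128)–(3.129) p.421] [cite: Balaban1985Averaging, Prop. 2 p.26] -/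
theorem G1QY_GpPhysY_isSymmTr_parKnitY (hG : G ≤ B7Prop2Explicit.unitaryUnits (Matrix (Fin N) (Fin N) ℂ)) {U : CfgY (Matrix (Fin N) (Fin N) ℂ) i}
    (hU : ∀ μ x, U μ x ∈ G) (hpar : ∀ z w : SiteY i, parKnitY i U z w ∈ G) (hQ : IsAdjTr (fun _ => (1 : ℝ)) (fun _ => (1 : ℝ)) (𝔮 U) (𝔮s U))
    (Δ2 : BondOpY (Matrix (Fin N) (Fin N) ℂ) i) (hΔ2 : IsSymmTr (fun _ => (1 : ℝ)) (Δ2 U)) :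
    IsSymmTr (fun _ => (1 : ℝ)) (G1QY i 𝔮 𝔮s (parKnitY i) (GpPhysY i (parKnitY i)) Δ2 U) :=
  G1QY_isSymmTr i 𝔮 𝔮s (parKnitY i) (GpPhysY i (parKnitY i)) Δ2 U hG hU hQ (isSymmTr_GpPhysY_parKnitY i hG hU hpar)
    (RY_GpPhysY_parKnitY_isSymmTr i hG hU hpar) hΔ2

/-- `(𝔮G₁𝔮⋆)⁻¹(U)` fed `G′_phys` over the knit transporter IS SYMMETRIC at such data. [cite: Balaban1985BackgroundPropagators, (3.132) p.422] [cite: Balaban1985Averaging, Prop. 2 p.26] -/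
theorem QG1QinvQY_GpPhysY_isSymmTr_parKnitY (hG : G ≤ B7Prop2Explicit.unitaryUnits (Matrix (Fin N) (Fin N) ℂ)) {U : CfgY (Matrix (Fin N) (Fin N) ℂ) i}
    (hU : ∀ μ x, U μ x ∈ G) (hpar : ∀ z w : SiteY i, parKnitY i U z w ∈ G) (hQ : IsAdjTr (fun _ => (1 : ℝ)) (fun _ => (1 : ℝ)) (𝔮 U) (𝔮s U))
    (Δ2 : BondOpY (Matrix (Fin N) (Fin N) ℂ) i) (hΔ2 : IsSymmTr (fun _ => (1 : ℝ)) (Δ2 U)) :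
    IsSymmTr (fun _ => (1 : ℝ)) (QG1QinvQY i 𝔮 𝔮s (parKnitY i) (GpPhysY i (parKnitY i)) Δ2 U) :=
  QG1QinvQY_isSymmTr i 𝔮 𝔮s (parKnitY i) (GpPhysY i (parKnitY i)) Δ2 U hG hU hQ (isSymmTr_GpPhysY_parKnitY i hG hU hpar)
    (RY_GpPhysY_parKnitY_isSymmTr i hG hU hpar) hΔ2

/-- ★★ `𝔊[𝔮](U)` (3.153) fed `G′_phys` over the knit transporter IS SYMMETRIC at such data. [cite: Balaban1985BackgroundPropagators, (3.153) p.426] [cite: Balaban1985Averaging, Prop. 2 p.26] -/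
theorem GGQY_GpPhysY_isSymmTr_parKnitY (hG : G ≤ B7Prop2Explicit.unitaryUnits (Matrix (Fin N) (Fin N) ℂ)) {U : CfgY (Matrix (Fin N) (Fin N) ℂ) i}
    (hU : ∀ μ x, U μ x ∈ G) (hpar : ∀ z w : SiteY i, parKnitY i U z w ∈ G) (hQ : IsAdjTr (fun _ => (1 : ℝ)) (fun _ => (1 : ℝ)) (𝔮 U) (𝔮s U))
    (Δ2 : BondOpY (Matrix (Fin N) (Fin N) ℂ) i) (hΔ2 : IsSymmTr (fun _ => (1 : ℝ)) (Δ2 U)) :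
    IsSymmTr (fun _ => (1 : ℝ)) (GGQY i 𝔮 𝔮s (parKnitY i) (GpPhysY i (parKnitY i)) Δ2 U) :=
  GGQY_isSymmTr i 𝔮 𝔮s (parKnitY i) (GpPhysY i (parKnitY i)) Δ2 U hG hU hQ (isSymmTr_GpPhysY_parKnitY i hG hU hpar)
    (RY_GpPhysY_parKnitY_isSymmTr i hG hU hpar) hΔ2

/-- ★★★ **THE UNIT `(𝔮G₁𝔮⋆)(U)` FROM `Δ⁽¹⁾(U) > 0`, WITH `G′_phys (parKnitY)` IN THE COMPOSITES** (the certificate's `hUQ` shape at the v11 record), for an adjoint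
pair with `𝔮⋆(U)` injective. [cite: Balaban1985BackgroundPropagators, (3.132) p.422, (3.128) p.421, (3.138) p.423] -/
theorem isUnit_QGQOfQY_G1QY_recordK_of_posDefTr {U : CfgY (Matrix (Fin N) (Fin N) ℂ) i}
    (hQ : IsAdjTr (fun _ => (1 : ℝ)) (fun _ => (1 : ℝ)) (𝔮 U) (𝔮s U)) (hinj : Function.Injective (𝔮s U)) (Δ2 : BondOpY (Matrix (Fin N) (Fin N) ℂ) i)
    (hΔ1 : PosDefTr (fun _ => (1 : ℝ)) (deltaOneQY i 𝔮 𝔮s (parKnitY i) (GpPhysY i (parKnitY i)) Δ2 U)) :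
    IsUnit (QGQOfQY i 𝔮 𝔮s (G1QY i 𝔮 𝔮s (parKnitY i) (GpPhysY i (parKnitY i)) Δ2) U) :=
  isUnit_QGQOfQY_G1QY_of_posDefTr_deltaOneQY i 𝔮 𝔮s (parKnitY i) (GpPhysY i (parKnitY i)) Δ2 U hQ hinj hΔ1

end SymmK

/-! ## §3 ★★★ THE v11 LETTERS OF RECORD, THE TWO STAR INSTANCES `opsYStOfRecordV11E ∕ opsYNuStOfRecordV11E` AND THEIR FACES -/

section Record

open scoped Matrix.Norms.L2Operator

/-- ★★★ **THE v11 LETTERS OF RECORD** over an index-level averaging pair family `(𝔮, 𝔮⋆)` flat at `U = 1` and a residual family `𝔯`: memberwise `covLettersY_v11`.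
[cite: Balaban1985BackgroundPropagators, (3.19) p.393, (3.115) p.418, (3.122)–(3.132) pp.420–422] [cite: Balaban1985Averaging, Prop. 2 p.26] -/
def lettersYOfRecordV11 (N : ℕ) (θ : Stage3Params) (Mstar : ℕ) (𝔮 : QFamY N θ) (𝔮s : QsFamY N θ)
    (h𝔮 : ∀ i, 𝔮 i (fun _ _ => 1) = liftMatY (Matrix (Fin N) (Fin N) ℂ) (qK i))
    (h𝔮s : ∀ i, 𝔮s i (fun _ _ => 1) = liftMatY (Matrix (Fin N) (Fin N) ℂ) (qsK i)) (𝔯 : ResY N θ Mstar) : LettersY N θ Mstar :=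
  fun x => covLettersY_v11 (Matrix (Fin N) (Fin N) ℂ) x 𝔮 𝔮s (h𝔮 x.toKIdx) (h𝔮s x.toKIdx) (𝔯 x)

/-- ★★★ **THE v11 STAR INSTANCE OF RECORD** over an averaging pair family `(𝔮, 𝔮⋆)` flat at `U = 1`: the star Sect.-E constructor `opsYSectESt` over
dag-n06-i's site-(3.49) layer, BOTH at the v11 letters of record `lettersYOfRecordV11 … 𝔮 𝔮⋆ h𝔮 h𝔮⋆ 𝔯` (the nine `Q`-dependent letters rebuilt over the pair,
composites fed `G′_phys`), over the KNIT-KEYED base chain `parS := parKnitY` — the shape of `opsYStOfRecordV10E` (same constructor, knit transporters).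
[cite: Balaban1985BackgroundPropagators, Thms 3.1–3.15 pp.397–432, (3.115) p.418, (3.122)–(3.132) pp.420–422, (3.156)–(3.158) p.428; Balaban1984PropagatorsII, (2.3) p.224] -/
def opsYStOfRecordV11E (N : ℕ) (θ : Stage3Params) (Mstar : ℕ) (𝔮 : QFamY N θ) (𝔮s : QsFamY N θ)
    (h𝔮 : ∀ i, 𝔮 i (fun _ _ => 1) = liftMatY (Matrix (Fin N) (Fin N) ℂ) (qK i))
    (h𝔮s : ∀ i, 𝔮s i (fun _ _ => 1) = liftMatY (Matrix (Fin N) (Fin N) ℂ) (qsK i)) (𝔯 : ResY N θ Mstar) (𝔢 : SectEStY N θ Mstar)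
    (𝔴 : RWEY N θ Mstar) (𝔈 : ExpsY N θ Mstar) : OpsY N θ Mstar :=
  opsYSectESt N θ Mstar (opsYS349OfLetters N θ Mstar (lettersYOfRecordV11 N θ Mstar 𝔮 𝔮s h𝔮 h𝔮s 𝔯) 𝔈)
    (lettersYOfRecordV11 N θ Mstar 𝔮 𝔮s h𝔮 h𝔮s 𝔯) 𝔢 𝔴

/-- ★★★ **THE v11 STAR INSTANCE OF RECORD WITH ROW 26 `ν`-READ** over an averaging pair family: `opsYSectESt … (opsYS349NuOfLetters … 𝔏 𝔈) 𝔏 𝔢 𝔴` at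
`𝔏 := lettersYOfRecordV11 … 𝔮 𝔮⋆ h𝔮 h𝔮⋆ 𝔯` — the shape the N06 certificate of record reads (`opsYNuStOfRecordV4PE ∕ V10E`), over the knit-keyed base chain.
[cite: Balaban1985BackgroundPropagators, Thms 3.1–3.15 pp.397–432, (3.115) p.418, (3.132) p.422, (3.156)–(3.158) p.428; Balaban1984PropagatorsII, (2.3) p.224] -/
def opsYNuStOfRecordV11E (N : ℕ) (θ : Stage3Params) (Mstar : ℕ) (𝔮 : QFamY N θ) (𝔮s : QsFamY N θ)
    (h𝔮 : ∀ i, 𝔮 i (fun _ _ => 1) = liftMatY (Matrix (Fin N) (Fin N) ℂ) (qK i))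
    (h𝔮s : ∀ i, 𝔮s i (fun _ _ => 1) = liftMatY (Matrix (Fin N) (Fin N) ℂ) (qsK i)) (𝔯 : ResY N θ Mstar) (𝔢 : SectEStY N θ Mstar)
    (𝔴 : RWEY N θ Mstar) (𝔈 : ExpsY N θ Mstar) : OpsY N θ Mstar :=
  opsYSectESt N θ Mstar (opsYS349NuOfLetters N θ Mstar (lettersYOfRecordV11 N θ Mstar 𝔮 𝔮s h𝔮 h𝔮s 𝔯) 𝔈)
    (lettersYOfRecordV11 N θ Mstar 𝔮 𝔮s h𝔮 h𝔮s 𝔯) 𝔢 𝔴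

variable (N : ℕ) (θ : Stage3Params) (Mstar : ℕ) (𝔮 : QFamY N θ) (𝔮s : QsFamY N θ)
  (h𝔮 : ∀ i, 𝔮 i (fun _ _ => 1) = liftMatY (Matrix (Fin N) (Fin N) ℂ) (qK i))
  (h𝔮s : ∀ i, 𝔮s i (fun _ _ => 1) = liftMatY (Matrix (Fin N) (Fin N) ℂ) (qsK i)) (𝔯 : ResY N θ Mstar)

/-- the pair-independent letters of the v11 record, by name: KNIT site transporter `parKnitY`, taxicab bond transporter `parBY`, `G′ = GpY (parKnitY)`,
`C = (Q′G′²Q′*)⁻¹` over `(parKnitY, GpY parKnitY)`; `P349 ∕ Ck` are the record's pins (= the v4P record's, `rfl`).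
[cite: Balaban1985BackgroundPropagators, (3.19) p.393, (3.24)–(3.25) p.394, (3.48) p.398, Thm 3.14 pp.426–427, bookkeeping] -/
theorem lettersYOfRecordV11_base (x : MemberY θ.d₆ θ.ℓ₆ θ.hd' θ.hL' θ.b₀ θ.b₁ Mstar) :
    (lettersYOfRecordV11 N θ Mstar 𝔮 𝔮s h𝔮 h𝔮s 𝔯 x).parS = parKnitY x.toKIdx ∧
      (lettersYOfRecordV11 N θ Mstar 𝔮 𝔮s h𝔮 h𝔮s 𝔯 x).parB = parBY x.toKIdx ∧
      (lettersYOfRecordV11 N θ Mstar 𝔮 𝔮s h𝔮 h𝔮s 𝔯 x).Gp = GpY x.toKIdx (parKnitY x.toKIdx) ∧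
      (lettersYOfRecordV11 N θ Mstar 𝔮 𝔮s h𝔮 h𝔮s 𝔯 x).C = CY x.toKIdx (parKnitY x.toKIdx) (GpY x.toKIdx (parKnitY x.toKIdx)) ∧
      (lettersYOfRecordV11 N θ Mstar 𝔮 𝔮s h𝔮 h𝔮s 𝔯 x).P349 = (lettersYOfRecordV4P N θ Mstar 𝔯 x).P349 ∧
      (lettersYOfRecordV11 N θ Mstar 𝔮 𝔮s h𝔮 h𝔮s 𝔯 x).Ck = (lettersYOfRecordV4P N θ Mstar 𝔯 x).Ck := ⟨rfl, rfl, rfl, rfl, rfl, rfl⟩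

/-- ★ the Sect. B∕D∕E letters of the v11 record, by name: THE `Q`-DEPENDENT COMPOSITES OVER THE PAIR `(𝔮 x, 𝔮⋆ x)` FED `G′_phys` (the certificate's
`hGco12 ∕ hG1co12 ∕ hGGco12 ∕ hHm12 ∕ hH1m12 ∕ hQ ∕ hQ₁` pins at the v11 record name these right-hand sides), and `GA = G[𝔮 x]` at lattice units.
[cite: Balaban1985BackgroundPropagators, (3.27) p.395, (3.122)–(3.132) pp.420–422, (3.153) p.426, Thm 3.14 pp.426–427, bookkeeping] -/
theorem lettersYOfRecordV11_sectDE (x : MemberY θ.d₆ θ.ℓ₆ θ.hd' θ.hL' θ.b₀ θ.b₁ Mstar) :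
    (lettersYOfRecordV11 N θ Mstar 𝔮 𝔮s h𝔮 h𝔮s 𝔯 x).GD =
        GDQY x.toKIdx (𝔮 x.toKIdx) (𝔮s x.toKIdx) (parKnitY x.toKIdx) (GpPhysY x.toKIdx (parKnitY x.toKIdx)) ∧
      (lettersYOfRecordV11 N θ Mstar 𝔮 𝔮s h𝔮 h𝔮s 𝔯 x).QGQinv =
        QGQinvQY x.toKIdx (𝔮 x.toKIdx) (𝔮s x.toKIdx) (parKnitY x.toKIdx) (GpPhysY x.toKIdx (parKnitY x.toKIdx)) ∧
      (lettersYOfRecordV11 N θ Mstar 𝔮 𝔮s h𝔮 h𝔮s 𝔯 x).H =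
        HDQY x.toKIdx (𝔮 x.toKIdx) (𝔮s x.toKIdx) (parKnitY x.toKIdx) (GpPhysY x.toKIdx (parKnitY x.toKIdx)) ∧
      (lettersYOfRecordV11 N θ Mstar 𝔮 𝔮s h𝔮 h𝔮s 𝔯 x).G₁ =
        G1QY x.toKIdx (𝔮 x.toKIdx) (𝔮s x.toKIdx) (parKnitY x.toKIdx) (GpPhysY x.toKIdx (parKnitY x.toKIdx)) (𝔯 x).Δ2 ∧
      (lettersYOfRecordV11 N θ Mstar 𝔮 𝔮s h𝔮 h𝔮s 𝔯 x).QG1Qinv =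
        QG1QinvQY x.toKIdx (𝔮 x.toKIdx) (𝔮s x.toKIdx) (parKnitY x.toKIdx) (GpPhysY x.toKIdx (parKnitY x.toKIdx)) (𝔯 x).Δ2 ∧
      (lettersYOfRecordV11 N θ Mstar 𝔮 𝔮s h𝔮 h𝔮s 𝔯 x).H₁ =
        H1QY x.toKIdx (𝔮 x.toKIdx) (𝔮s x.toKIdx) (parKnitY x.toKIdx) (GpPhysY x.toKIdx (parKnitY x.toKIdx)) (𝔯 x).Δ2 ∧
      (lettersYOfRecordV11 N θ Mstar 𝔮 𝔮s h𝔮 h𝔮s 𝔯 x).GG =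
        GGQY x.toKIdx (𝔮 x.toKIdx) (𝔮s x.toKIdx) (parKnitY x.toKIdx) (GpPhysY x.toKIdx (parKnitY x.toKIdx)) (𝔯 x).Δ2 ∧
      (lettersYOfRecordV11 N θ Mstar 𝔮 𝔮s h𝔮 h𝔮s 𝔯 x).GA =
        GAQY x.toKIdx (𝔮 x.toKIdx) (𝔮s x.toKIdx) (parKnitY x.toKIdx) (GpY x.toKIdx (parKnitY x.toKIdx)) :=
  ⟨rfl, rfl, rfl, rfl, rfl, rfl, rfl, rfl⟩

/-- ★ the v11 record's `GA = G[𝔮 x]` is ALSO the composite fed `G′_phys`. [cite: Balaban1985BackgroundPropagators, (3.26)–(3.27) p.395, (3.25) p.394] -/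
theorem lettersYOfRecordV11_GA_phys (x : MemberY θ.d₆ θ.ℓ₆ θ.hd' θ.hL' θ.b₀ θ.b₁ Mstar) :
    (lettersYOfRecordV11 N θ Mstar 𝔮 𝔮s h𝔮 h𝔮s 𝔯 x).GA =
      GAQY x.toKIdx (𝔮 x.toKIdx) (𝔮s x.toKIdx) (parKnitY x.toKIdx) (GpPhysY x.toKIdx (parKnitY x.toKIdx)) :=
  (GAQY_GpPhysY x.toKIdx (𝔮 x.toKIdx) (𝔮s x.toKIdx) (parKnitY x.toKIdx)).symm

variable {G : Subgroup (Matrix (Fin N) (Fin N) ℂ)ˣ}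

/-- ★★ **THE v11 RECORD'S `GD` IS SYMMETRIC** at every `G`-valued configuration, `G ≤ U(N)`, at which the pair `(𝔮 x, 𝔮⋆ x)` is adjoint.
[cite: Balaban1985BackgroundPropagators, (3.122)–(3.123) p.420, (3.35) p.396] -/
theorem lettersYOfRecordV11_GD_isSymmTr (hG : G ≤ B7Prop2Explicit.unitaryUnits (Matrix (Fin N) (Fin N) ℂ))
    (x : MemberY θ.d₆ θ.ℓ₆ θ.hd' θ.hL' θ.b₀ θ.b₁ Mstar) {U : CfgY (Matrix (Fin N) (Fin N) ℂ) x.toKIdx} (hU : ∀ μ z, U μ z ∈ G)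
    (hpar : ∀ z w : SiteY x.toKIdx, parKnitY x.toKIdx U z w ∈ G) (hQ : IsAdjTr (fun _ => (1 : ℝ)) (fun _ => (1 : ℝ)) (𝔮 x.toKIdx U) (𝔮s x.toKIdx U)) :
    IsSymmTr (fun _ => (1 : ℝ)) ((lettersYOfRecordV11 N θ Mstar 𝔮 𝔮s h𝔮 h𝔮s 𝔯 x).GD U) :=
  GDQY_GpPhysY_isSymmTr_parKnitY x.toKIdx (𝔮 x.toKIdx) (𝔮s x.toKIdx) hG hU hpar hQ

/-- ★★ **THE v11 RECORD'S `G₁` IS SYMMETRIC** at every `G`-valued configuration at which the pair is adjoint and the residual letter `(𝔯 x).Δ2` symmetric.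
[cite: Balaban1985BackgroundPropagators, (3.128)–(3.129) p.421, (3.35) p.396] -/
theorem lettersYOfRecordV11_G₁_isSymmTr (hG : G ≤ B7Prop2Explicit.unitaryUnits (Matrix (Fin N) (Fin N) ℂ))
    (x : MemberY θ.d₆ θ.ℓ₆ θ.hd' θ.hL' θ.b₀ θ.b₁ Mstar) {U : CfgY (Matrix (Fin N) (Fin N) ℂ) x.toKIdx} (hU : ∀ μ z, U μ z ∈ G)
    (hpar : ∀ z w : SiteY x.toKIdx, parKnitY x.toKIdx U z w ∈ G) (hQ : IsAdjTr (fun _ => (1 : ℝ)) (fun _ => (1 : ℝ)) (𝔮 x.toKIdx U) (𝔮s x.toKIdx U)) (hΔ2 : IsSymmTr (fun _ => (1 : ℝ)) ((𝔯 x).Δ2 U)) :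
    IsSymmTr (fun _ => (1 : ℝ)) ((lettersYOfRecordV11 N θ Mstar 𝔮 𝔮s h𝔮 h𝔮s 𝔯 x).G₁ U) :=
  G1QY_GpPhysY_isSymmTr_parKnitY x.toKIdx (𝔮 x.toKIdx) (𝔮s x.toKIdx) hG hU hpar hQ (𝔯 x).Δ2 hΔ2

/-- ★★ **THE v11 RECORD'S `GG = 𝔊` IS SYMMETRIC** at every `G`-valued configuration at which the pair is adjoint and the residual letter `(𝔯 x).Δ2` symmetric.
[cite: Balaban1985BackgroundPropagators, (3.153) p.426, (3.35) p.396] -/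
theorem lettersYOfRecordV11_GG_isSymmTr (hG : G ≤ B7Prop2Explicit.unitaryUnits (Matrix (Fin N) (Fin N) ℂ))
    (x : MemberY θ.d₆ θ.ℓ₆ θ.hd' θ.hL' θ.b₀ θ.b₁ Mstar) {U : CfgY (Matrix (Fin N) (Fin N) ℂ) x.toKIdx} (hU : ∀ μ z, U μ z ∈ G)
    (hpar : ∀ z w : SiteY x.toKIdx, parKnitY x.toKIdx U z w ∈ G) (hQ : IsAdjTr (fun _ => (1 : ℝ)) (fun _ => (1 : ℝ)) (𝔮 x.toKIdx U) (𝔮s x.toKIdx U)) (hΔ2 : IsSymmTr (fun _ => (1 : ℝ)) ((𝔯 x).Δ2 U)) :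
    IsSymmTr (fun _ => (1 : ℝ)) ((lettersYOfRecordV11 N θ Mstar 𝔮 𝔮s h𝔮 h𝔮s 𝔯 x).GG U) :=
  GGQY_GpPhysY_isSymmTr_parKnitY x.toKIdx (𝔮 x.toKIdx) (𝔮s x.toKIdx) hG hU hpar hQ (𝔯 x).Δ2 hΔ2

/-- ★★★ **THE CERTIFICATE's `hsymD` AT THE v11 RECORD** (`GD ∧ G₁ ∧ GG` symmetric at special-unitary configurations) from three displayed hypotheses: the pair
`(𝔮 x, 𝔮⋆ x)` ADJOINT at special-unitary configurations ((L3) of `Node00.OpsYQLetter`), the KNIT LEGS UNITARY there (`hpar`; on the regime of record by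
`OpsYQLetter.parKnitY_mem_unitary_of_regQY`), and a symmetric residual letter.
[cite: Balaban1985BackgroundPropagators, (3.122) p.420, (3.128) p.421, (3.153) p.426, (3.35) p.396, p.393 (Q* the adjoint of Q)] [cite: Balaban1985Averaging, Prop. 2 p.26] -/
theorem lettersYOfRecordV11_symmDG₁GG
    (hQ : ∀ (x : MemberY θ.d₆ θ.ℓ₆ θ.hd' θ.hL' θ.b₀ θ.b₁ Mstar) (U : CfgY (Matrix (Fin N) (Fin N) ℂ) x.toKIdx), (∀ μ z, U μ z ∈ specialUnitaryUnits (Fin N)) →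
      IsAdjTr (fun _ => (1 : ℝ)) (fun _ => (1 : ℝ)) (𝔮 x.toKIdx U) (𝔮s x.toKIdx U))
    (hpar : ∀ (x : MemberY θ.d₆ θ.ℓ₆ θ.hd' θ.hL' θ.b₀ θ.b₁ Mstar) (U : CfgY (Matrix (Fin N) (Fin N) ℂ) x.toKIdx), (∀ μ z, U μ z ∈ specialUnitaryUnits (Fin N)) →
      ∀ z w : SiteY x.toKIdx, parKnitY x.toKIdx U z w ∈ B7Prop2Explicit.unitaryUnits (Matrix (Fin N) (Fin N) ℂ))
    (hΔ2 : ∀ (x : MemberY θ.d₆ θ.ℓ₆ θ.hd' θ.hL' θ.b₀ θ.b₁ Mstar) (U : CfgY (Matrix (Fin N) (Fin N) ℂ) x.toKIdx), (∀ μ z, U μ z ∈ specialUnitaryUnits (Fin N)) →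
      IsSymmTr (fun _ => (1 : ℝ)) ((𝔯 x).Δ2 U)) :
    ∀ (x : MemberY θ.d₆ θ.ℓ₆ θ.hd' θ.hL' θ.b₀ θ.b₁ Mstar) (U : CfgY (Matrix (Fin N) (Fin N) ℂ) x.toKIdx), (∀ μ z, U μ z ∈ specialUnitaryUnits (Fin N)) →
      IsSymmTr (fun _ => (1 : ℝ)) ((lettersYOfRecordV11 N θ Mstar 𝔮 𝔮s h𝔮 h𝔮s 𝔯 x).GD U) ∧
        IsSymmTr (fun _ => (1 : ℝ)) ((lettersYOfRecordV11 N θ Mstar 𝔮 𝔮s h𝔮 h𝔮s 𝔯 x).G₁ U) ∧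
        IsSymmTr (fun _ => (1 : ℝ)) ((lettersYOfRecordV11 N θ Mstar 𝔮 𝔮s h𝔮 h𝔮s 𝔯 x).GG U) :=
  fun x U hU =>
    ⟨lettersYOfRecordV11_GD_isSymmTr N θ Mstar 𝔮 𝔮s h𝔮 h𝔮s 𝔯 (G := B7Prop2Explicit.unitaryUnits _) le_rfl x
        (fun μ z => specialUnitaryUnits_le_unitaryUnits (hU μ z)) (hpar x U hU) (hQ x U hU),
      lettersYOfRecordV11_G₁_isSymmTr N θ Mstar 𝔮 𝔮s h𝔮 h𝔮s 𝔯 (G := B7Prop2Explicit.unitaryUnits _) le_rfl x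
        (fun μ z => specialUnitaryUnits_le_unitaryUnits (hU μ z)) (hpar x U hU) (hQ x U hU) (hΔ2 x U hU),
      lettersYOfRecordV11_GG_isSymmTr N θ Mstar 𝔮 𝔮s h𝔮 h𝔮s 𝔯 (G := B7Prop2Explicit.unitaryUnits _) le_rfl x
        (fun μ z => specialUnitaryUnits_le_unitaryUnits (hU μ z)) (hpar x U hU) (hQ x U hU) (hΔ2 x U hU)⟩

/-- ★ **THE UNIT `(𝔮G₁𝔮⋆)(U)` AT THE v11 RECORD** from `Δ⁽¹⁾(U) > 0`, the adjointness of the pair at `U` and `𝔮⋆ x (U)` injective (the certificate's `hUQ`).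
[cite: Balaban1985BackgroundPropagators, (3.132) p.422, (3.128) p.421, (3.138) p.423] -/
theorem lettersYOfRecordV11_isUnit_QGQOfQY_G₁ (x : MemberY θ.d₆ θ.ℓ₆ θ.hd' θ.hL' θ.b₀ θ.b₁ Mstar) {U : CfgY (Matrix (Fin N) (Fin N) ℂ) x.toKIdx}
    (hQ : IsAdjTr (fun _ => (1 : ℝ)) (fun _ => (1 : ℝ)) (𝔮 x.toKIdx U) (𝔮s x.toKIdx U)) (hinj : Function.Injective (𝔮s x.toKIdx U))
    (hΔ1 : PosDefTr (fun _ => (1 : ℝ))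
      (deltaOneQY x.toKIdx (𝔮 x.toKIdx) (𝔮s x.toKIdx) (parKnitY x.toKIdx) (GpPhysY x.toKIdx (parKnitY x.toKIdx)) (𝔯 x).Δ2 U)) :
    IsUnit (QGQOfQY x.toKIdx (𝔮 x.toKIdx) (𝔮s x.toKIdx) (lettersYOfRecordV11 N θ Mstar 𝔮 𝔮s h𝔮 h𝔮s 𝔯 x).G₁ U) :=
  isUnit_QGQOfQY_G1QY_recordK_of_posDefTr x.toKIdx (𝔮 x.toKIdx) (𝔮s x.toKIdx) hQ hinj (𝔯 x).Δ2 hΔ1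

/-- ★ the same with injectivity DISCHARGED from «`𝔮 x (U)` onto» ((L2)). [cite: Balaban1985BackgroundPropagators, (3.132) p.422, (3.128) p.421] [cite: Balaban1985Averaging, (15) p.19] -/
theorem lettersYOfRecordV11_isUnit_QGQOfQY_G₁_of_surjective (x : MemberY θ.d₆ θ.ℓ₆ θ.hd' θ.hL' θ.b₀ θ.b₁ Mstar)
    {U : CfgY (Matrix (Fin N) (Fin N) ℂ) x.toKIdx} (hQ : IsAdjTr (fun _ => (1 : ℝ)) (fun _ => (1 : ℝ)) (𝔮 x.toKIdx U) (𝔮s x.toKIdx U))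
    (hsurj : Function.Surjective (𝔮 x.toKIdx U))
    (hΔ1 : PosDefTr (fun _ => (1 : ℝ))
      (deltaOneQY x.toKIdx (𝔮 x.toKIdx) (𝔮s x.toKIdx) (parKnitY x.toKIdx) (GpPhysY x.toKIdx (parKnitY x.toKIdx)) (𝔯 x).Δ2 U)) :
    IsUnit (QGQOfQY x.toKIdx (𝔮 x.toKIdx) (𝔮s x.toKIdx) (lettersYOfRecordV11 N θ Mstar 𝔮 𝔮s h𝔮 h𝔮s 𝔯 x).G₁ U) :=
  lettersYOfRecordV11_isUnit_QGQOfQY_G₁ N θ Mstar 𝔮 𝔮s h𝔮 h𝔮s 𝔯 x hQ (injective_of_isAdjTr_of_surjective (fun _ => one_pos) hQ hsurj) hΔ1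

/-- the v11 letters of record at a member (`rfl`). [cite: Balaban1985BackgroundPropagators, (3.122)–(3.132) pp.420–422, bookkeeping] -/
theorem lettersYOfRecordV11_apply (x : MemberY θ.d₆ θ.ℓ₆ θ.hd' θ.hL' θ.b₀ θ.b₁ Mstar) :
    lettersYOfRecordV11 N θ Mstar 𝔮 𝔮s h𝔮 h𝔮s 𝔯 x = covLettersY_v11 (Matrix (Fin N) (Fin N) ℂ) x 𝔮 𝔮s (h𝔮 x.toKIdx) (h𝔮s x.toKIdx) (𝔯 x) := rfl

variable (𝔢 : SectEStY N θ Mstar) (𝔴 : RWEY N θ Mstar) (𝔈 : ExpsY N θ Mstar)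

/-! ### The two instances, unfolded field by field (`rfl` transport for the certificate's rows) -/

/-- the plain v11 star instance at a member, unfolded. [cite: Balaban1985BackgroundPropagators, Thm 3.15 p.432, bookkeeping] -/
theorem opsYStOfRecordV11E_apply (x : MemberY θ.d₆ θ.ℓ₆ θ.hd' θ.hL' θ.b₀ θ.b₁ Mstar) :
    opsYStOfRecordV11E N θ Mstar 𝔮 𝔮s h𝔮 h𝔮s 𝔯 𝔢 𝔴 𝔈 x =
      operatorLayerYSectESt (Matrix (Fin N) (Fin N) ℂ) (specialUnitaryUnits (Fin N)) x
        (opsYS349OfLetters N θ Mstar (lettersYOfRecordV11 N θ Mstar 𝔮 𝔮s h𝔮 h𝔮s 𝔯) 𝔈 x) (lettersYOfRecordV11 N θ Mstar 𝔮 𝔮s h𝔮 h𝔮s 𝔯 x)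
        (𝔢 x) (𝔴 x) := rfl

/-- the `ν`-read v11 star instance at a member, unfolded. [cite: Balaban1985BackgroundPropagators, Thm 3.15 p.432, (3.132) p.422, bookkeeping] -/
theorem opsYNuStOfRecordV11E_apply (x : MemberY θ.d₆ θ.ℓ₆ θ.hd' θ.hL' θ.b₀ θ.b₁ Mstar) :
    opsYNuStOfRecordV11E N θ Mstar 𝔮 𝔮s h𝔮 h𝔮s 𝔯 𝔢 𝔴 𝔈 x =
      operatorLayerYSectESt (Matrix (Fin N) (Fin N) ℂ) (specialUnitaryUnits (Fin N)) x
        (opsYS349NuOfLetters N θ Mstar (lettersYOfRecordV11 N θ Mstar 𝔮 𝔮s h𝔮 h𝔮s 𝔯) 𝔈 x) (lettersYOfRecordV11 N θ Mstar 𝔮 𝔮s h𝔮 h𝔮s 𝔯 x)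
        (𝔢 x) (𝔴 x) := rfl

/-- ★ ROWS 17, 20–23, 26 and the walk slot of the plain v11 star instance ARE def-Y's BASE READINGS `opsYOfLetters` of the v11 letters of record (`rfl`).
[cite: Balaban1985BackgroundPropagators, Thms 3.1–3.14 pp.397–427, (3.49) p.399, bookkeeping] -/
theorem opsYStOfRecordV11E_letters (x : MemberY θ.d₆ θ.ℓ₆ θ.hd' θ.hL' θ.b₀ θ.b₁ Mstar) :
    (opsYStOfRecordV11E N θ Mstar 𝔮 𝔮s h𝔮 h𝔮s 𝔯 𝔢 𝔴 𝔈 x).Gp = (opsYOfLetters N θ Mstar (lettersYOfRecordV11 N θ Mstar 𝔮 𝔮s h𝔮 h𝔮s 𝔯) 𝔈 x).Gp ∧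
      (opsYStOfRecordV11E N θ Mstar 𝔮 𝔮s h𝔮 h𝔮s 𝔯 𝔢 𝔴 𝔈 x).GA = (opsYOfLetters N θ Mstar (lettersYOfRecordV11 N θ Mstar 𝔮 𝔮s h𝔮 h𝔮s 𝔯) 𝔈 x).GA ∧
      (opsYStOfRecordV11E N θ Mstar 𝔮 𝔮s h𝔮 h𝔮s 𝔯 𝔢 𝔴 𝔈 x).Cinv = (opsYOfLetters N θ Mstar (lettersYOfRecordV11 N θ Mstar 𝔮 𝔮s h𝔮 h𝔮s 𝔯) 𝔈 x).Cinv ∧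
      (opsYStOfRecordV11E N θ Mstar 𝔮 𝔮s h𝔮 h𝔮s 𝔯 𝔢 𝔴 𝔈 x).GD = (opsYOfLetters N θ Mstar (lettersYOfRecordV11 N θ Mstar 𝔮 𝔮s h𝔮 h𝔮s 𝔯) 𝔈 x).GD ∧
      (opsYStOfRecordV11E N θ Mstar 𝔮 𝔮s h𝔮 h𝔮s 𝔯 𝔢 𝔴 𝔈 x).G₁ = (opsYOfLetters N θ Mstar (lettersYOfRecordV11 N θ Mstar 𝔮 𝔮s h𝔮 h𝔮s 𝔯) 𝔈 x).G₁ ∧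
      (opsYStOfRecordV11E N θ Mstar 𝔮 𝔮s h𝔮 h𝔮s 𝔯 𝔢 𝔴 𝔈 x).H = (opsYOfLetters N θ Mstar (lettersYOfRecordV11 N θ Mstar 𝔮 𝔮s h𝔮 h𝔮s 𝔯) 𝔈 x).H ∧
      (opsYStOfRecordV11E N θ Mstar 𝔮 𝔮s h𝔮 h𝔮s 𝔯 𝔢 𝔴 𝔈 x).H₁ = (opsYOfLetters N θ Mstar (lettersYOfRecordV11 N θ Mstar 𝔮 𝔮s h𝔮 h𝔮s 𝔯) 𝔈 x).H₁ ∧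
      (opsYStOfRecordV11E N θ Mstar 𝔮 𝔮s h𝔮 h𝔮s 𝔯 𝔢 𝔴 𝔈 x).GG = (opsYOfLetters N θ Mstar (lettersYOfRecordV11 N θ Mstar 𝔮 𝔮s h𝔮 h𝔮s 𝔯) 𝔈 x).GG ∧
      (opsYStOfRecordV11E N θ Mstar 𝔮 𝔮s h𝔮 h𝔮s 𝔯 𝔢 𝔴 𝔈 x).Kdiff =
        (opsYOfLetters N θ Mstar (lettersYOfRecordV11 N θ Mstar 𝔮 𝔮s h𝔮 h𝔮s 𝔯) 𝔈 x).Kdiff ∧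
      (opsYStOfRecordV11E N θ Mstar 𝔮 𝔮s h𝔮 h𝔮s 𝔯 𝔢 𝔴 𝔈 x).QGQinv =
        (opsYOfLetters N θ Mstar (lettersYOfRecordV11 N θ Mstar 𝔮 𝔮s h𝔮 h𝔮s 𝔯) 𝔈 x).QGQinv ∧
      (opsYStOfRecordV11E N θ Mstar 𝔮 𝔮s h𝔮 h𝔮s 𝔯 𝔢 𝔴 𝔈 x).QG1Qinv =
        (opsYOfLetters N θ Mstar (lettersYOfRecordV11 N θ Mstar 𝔮 𝔮s h𝔮 h𝔮s 𝔯) 𝔈 x).QG1Qinv :=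
  ⟨rfl, rfl, rfl, rfl, rfl, rfl, rfl, rfl, rfl, rfl, rfl⟩

/-- ★ ROWS 17, 20–23 and the walk slot of the `ν`-read v11 star instance ARE def-Y's BASE READINGS `opsYOfLetters` of the v11 letters of record (`rfl`; its two
kernels of the operators of (3.132) are the `ν`-readings, `opsYNuStOfRecordV11E_QGQinv_QG1Qinv`). [cite: Balaban1985BackgroundPropagators, Thms 3.1–3.14 pp.397–427, (3.49) p.399, bookkeeping] -/
theorem opsYNuStOfRecordV11E_letters (x : MemberY θ.d₆ θ.ℓ₆ θ.hd' θ.hL' θ.b₀ θ.b₁ Mstar) :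
    (opsYNuStOfRecordV11E N θ Mstar 𝔮 𝔮s h𝔮 h𝔮s 𝔯 𝔢 𝔴 𝔈 x).Gp = (opsYOfLetters N θ Mstar (lettersYOfRecordV11 N θ Mstar 𝔮 𝔮s h𝔮 h𝔮s 𝔯) 𝔈 x).Gp ∧
      (opsYNuStOfRecordV11E N θ Mstar 𝔮 𝔮s h𝔮 h𝔮s 𝔯 𝔢 𝔴 𝔈 x).GA = (opsYOfLetters N θ Mstar (lettersYOfRecordV11 N θ Mstar 𝔮 𝔮s h𝔮 h𝔮s 𝔯) 𝔈 x).GA ∧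
      (opsYNuStOfRecordV11E N θ Mstar 𝔮 𝔮s h𝔮 h𝔮s 𝔯 𝔢 𝔴 𝔈 x).Cinv =
        (opsYOfLetters N θ Mstar (lettersYOfRecordV11 N θ Mstar 𝔮 𝔮s h𝔮 h𝔮s 𝔯) 𝔈 x).Cinv ∧
      (opsYNuStOfRecordV11E N θ Mstar 𝔮 𝔮s h𝔮 h𝔮s 𝔯 𝔢 𝔴 𝔈 x).GD = (opsYOfLetters N θ Mstar (lettersYOfRecordV11 N θ Mstar 𝔮 𝔮s h𝔮 h𝔮s 𝔯) 𝔈 x).GD ∧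
      (opsYNuStOfRecordV11E N θ Mstar 𝔮 𝔮s h𝔮 h𝔮s 𝔯 𝔢 𝔴 𝔈 x).G₁ = (opsYOfLetters N θ Mstar (lettersYOfRecordV11 N θ Mstar 𝔮 𝔮s h𝔮 h𝔮s 𝔯) 𝔈 x).G₁ ∧
      (opsYNuStOfRecordV11E N θ Mstar 𝔮 𝔮s h𝔮 h𝔮s 𝔯 𝔢 𝔴 𝔈 x).H = (opsYOfLetters N θ Mstar (lettersYOfRecordV11 N θ Mstar 𝔮 𝔮s h𝔮 h𝔮s 𝔯) 𝔈 x).H ∧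
      (opsYNuStOfRecordV11E N θ Mstar 𝔮 𝔮s h𝔮 h𝔮s 𝔯 𝔢 𝔴 𝔈 x).H₁ = (opsYOfLetters N θ Mstar (lettersYOfRecordV11 N θ Mstar 𝔮 𝔮s h𝔮 h𝔮s 𝔯) 𝔈 x).H₁ ∧
      (opsYNuStOfRecordV11E N θ Mstar 𝔮 𝔮s h𝔮 h𝔮s 𝔯 𝔢 𝔴 𝔈 x).GG = (opsYOfLetters N θ Mstar (lettersYOfRecordV11 N θ Mstar 𝔮 𝔮s h𝔮 h𝔮s 𝔯) 𝔈 x).GG ∧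
      (opsYNuStOfRecordV11E N θ Mstar 𝔮 𝔮s h𝔮 h𝔮s 𝔯 𝔢 𝔴 𝔈 x).Kdiff =
        (opsYOfLetters N θ Mstar (lettersYOfRecordV11 N θ Mstar 𝔮 𝔮s h𝔮 h𝔮s 𝔯) 𝔈 x).Kdiff :=
  ⟨rfl, rfl, rfl, rfl, rfl, rfl, rfl, rfl, rfl⟩

/-- ★ ROW 26's two kernels at the `ν`-read v11 star instance ARE the `ν`-readings of the genuine `(𝔮G̃𝔮⋆)⁻¹ ∕ (𝔮G₁𝔮⋆)⁻¹` OVER THE PAIR, FED `G′_phys`.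
[cite: Balaban1985BackgroundPropagators, (3.132) p.422, (3.123) p.420, (3.129) p.421, bookkeeping] -/
theorem opsYNuStOfRecordV11E_QGQinv_QG1Qinv (x : MemberY θ.d₆ θ.ℓ₆ θ.hd' θ.hL' θ.b₀ θ.b₁ Mstar) :
    (opsYNuStOfRecordV11E N θ Mstar 𝔮 𝔮s h𝔮 h𝔮s 𝔯 𝔢 𝔴 𝔈 x).QGQinv =
        siteKernelOfOpNu x.toKIdx (bg9Y (Matrix (Fin N) (Fin N) ℂ) (specialUnitaryUnits (Fin N)) x) (fun U => U) (nuY (θ.d₆ + 1) x.toKIdx)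
          (QGQinvQY x.toKIdx (𝔮 x.toKIdx) (𝔮s x.toKIdx) (parKnitY x.toKIdx) (GpPhysY x.toKIdx (parKnitY x.toKIdx))) ∧
      (opsYNuStOfRecordV11E N θ Mstar 𝔮 𝔮s h𝔮 h𝔮s 𝔯 𝔢 𝔴 𝔈 x).QG1Qinv =
        siteKernelOfOpNu x.toKIdx (bg9Y (Matrix (Fin N) (Fin N) ℂ) (specialUnitaryUnits (Fin N)) x) (fun U => U) (nuY (θ.d₆ + 1) x.toKIdx)
          (QG1QinvQY x.toKIdx (𝔮 x.toKIdx) (𝔮s x.toKIdx) (parKnitY x.toKIdx) (GpPhysY x.toKIdx (parKnitY x.toKIdx)) (𝔯 x).Δ2) :=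
  ⟨rfl, rfl⟩

/-- ★ ROWS 24–25 at both v11 star instances: `Ck` = the index-bond reading of the STAR `C^{(k)}(Λ; U) = CkStY` OVER THE v11 LETTERS OF RECORD (whose `δK`
(3.157) carries the pair's `(𝔮G₁𝔮⋆)⁻¹`) and the star letters `𝔢 x`; `GivenBy3185 = givenBy3185stY`, `HasRWExpC = hasRWExpCY (𝔴 x)`, `P349` = n06-i's site-(3.49)
reading (reads only `.Gp ∕ .parS` — pair-independent); the plain and the `ν`-read instance agree on these four.
[cite: Balaban1985BackgroundPropagators, Thm 3.15 (3.185)–(3.187) p.432, (3.157)–(3.158) p.428, (3.49) p.399, bookkeeping] -/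
theorem opsYNuStOfRecordV11E_sectE (x : MemberY θ.d₆ θ.ℓ₆ θ.hd' θ.hL' θ.b₀ θ.b₁ Mstar) :
    (opsYNuStOfRecordV11E N θ Mstar 𝔮 𝔮s h𝔮 h𝔮s 𝔯 𝔢 𝔴 𝔈 x).Ck =
        siteKernelOfOp x.toKIdx (bg9Y (Matrix (Fin N) (Fin N) ℂ) (specialUnitaryUnits (Fin N)) x) (fun U => U)
          (CkStY x (lettersYOfRecordV11 N θ Mstar 𝔮 𝔮s h𝔮 h𝔮s 𝔯 x) (𝔢 x)) id id ∧
      (opsYNuStOfRecordV11E N θ Mstar 𝔮 𝔮s h𝔮 h𝔮s 𝔯 𝔢 𝔴 𝔈 x).GivenBy3185 =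
        givenBy3185stY x (lettersYOfRecordV11 N θ Mstar 𝔮 𝔮s h𝔮 h𝔮s 𝔯 x) (𝔢 x) ∧
      (opsYNuStOfRecordV11E N θ Mstar 𝔮 𝔮s h𝔮 h𝔮s 𝔯 𝔢 𝔴 𝔈 x).HasRWExpC = hasRWExpCY (𝔴 x) ∧
      (opsYNuStOfRecordV11E N θ Mstar 𝔮 𝔮s h𝔮 h𝔮s 𝔯 𝔢 𝔴 𝔈 x).P349 =
        p349SiteY (Matrix (Fin N) (Fin N) ℂ) (specialUnitaryUnits (Fin N)) x (lettersYOfRecordV11 N θ Mstar 𝔮 𝔮s h𝔮 h𝔮s 𝔯 x) ∧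
      (opsYNuStOfRecordV11E N θ Mstar 𝔮 𝔮s h𝔮 h𝔮s 𝔯 𝔢 𝔴 𝔈 x).P349 =
        fineKernelOfSiteOp x.toKIdx (bg9Y (Matrix (Fin N) (Fin N) ℂ) (specialUnitaryUnits (Fin N)) x) (fun U => U)
          (P349Y x.toKIdx (parKnitY x.toKIdx) (GpY x.toKIdx (parKnitY x.toKIdx))) ∧
      (opsYStOfRecordV11E N θ Mstar 𝔮 𝔮s h𝔮 h𝔮s 𝔯 𝔢 𝔴 𝔈 x).Ck = (opsYNuStOfRecordV11E N θ Mstar 𝔮 𝔮s h𝔮 h𝔮s 𝔯 𝔢 𝔴 𝔈 x).Ck ∧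
      (opsYStOfRecordV11E N θ Mstar 𝔮 𝔮s h𝔮 h𝔮s 𝔯 𝔢 𝔴 𝔈 x).GivenBy3185 =
        (opsYNuStOfRecordV11E N θ Mstar 𝔮 𝔮s h𝔮 h𝔮s 𝔯 𝔢 𝔴 𝔈 x).GivenBy3185 ∧
      (opsYStOfRecordV11E N θ Mstar 𝔮 𝔮s h𝔮 h𝔮s 𝔯 𝔢 𝔴 𝔈 x).HasRWExpC =
        (opsYNuStOfRecordV11E N θ Mstar 𝔮 𝔮s h𝔮 h𝔮s 𝔯 𝔢 𝔴 𝔈 x).HasRWExpC ∧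
      (opsYStOfRecordV11E N θ Mstar 𝔮 𝔮s h𝔮 h𝔮s 𝔯 𝔢 𝔴 𝔈 x).P349 = (opsYNuStOfRecordV11E N θ Mstar 𝔮 𝔮s h𝔮 h𝔮s 𝔯 𝔢 𝔴 𝔈 x).P349 :=
  ⟨rfl, rfl, rfl, rfl, rfl, rfl, rfl, rfl, rfl⟩

/-- ★ ROW 24's kernel ENTRY at the `ν`-read v11 star instance: the sup over the unit ball of the STAR `C^{(k)}(Λ; U)` over the v11 letters, applied to a bond delta.
[cite: Balaban1985BackgroundPropagators, Thm 3.15 (3.187) p.432, bookkeeping] -/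
theorem opsYNuStOfRecordV11E_Ck_ker (x : MemberY θ.d₆ θ.ℓ₆ θ.hd' θ.hL' θ.b₀ θ.b₁ Mstar)
    (U : (bg9Y (Matrix (Fin N) (Fin N) ℂ) (specialUnitaryUnits (Fin N)) x).Cfg) (y y' : (geo9Y x).Site) :
    (opsYNuStOfRecordV11E N θ Mstar 𝔮 𝔮s h𝔮 h𝔮s 𝔯 𝔢 𝔴 𝔈 x).Ck.ker U y y' =
      ⨆ E : BallY (Matrix (Fin N) (Fin N) ℂ),
        ‖CkStY x (lettersYOfRecordV11 N θ Mstar 𝔮 𝔮s h𝔮 h𝔮s 𝔯 x) (𝔢 x) U (deltaY y' (E : Matrix (Fin N) (Fin N) ℂ)) y‖ := rfl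

/-- ★ the predicate ∕ expansion fields of both v11 star instances are `𝔈`'s (rows 1–3, 13–16, 18–19 transport by `rfl`).
[cite: Balaban1985BackgroundPropagators, Thms 3.4–3.13 pp.400–426, bookkeeping] -/
theorem opsYNuStOfRecordV11E_preds (x : MemberY θ.d₆ θ.ℓ₆ θ.hd' θ.hL' θ.b₀ θ.b₁ Mstar) :
    (opsYNuStOfRecordV11E N θ Mstar 𝔮 𝔮s h𝔮 h𝔮s 𝔯 𝔢 𝔴 𝔈 x).IsAnalyticExt = (𝔈 x).IsAnalyticExt ∧
      (opsYNuStOfRecordV11E N θ Mstar 𝔮 𝔮s h𝔮 h𝔮s 𝔯 𝔢 𝔴 𝔈 x).E37 = (𝔈 x).E37 ∧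
      (opsYNuStOfRecordV11E N θ Mstar 𝔮 𝔮s h𝔮 h𝔮s 𝔯 𝔢 𝔴 𝔈 x).EK39 = (𝔈 x).EK39 ∧
      (opsYNuStOfRecordV11E N θ Mstar 𝔮 𝔮s h𝔮 h𝔮s 𝔯 𝔢 𝔴 𝔈 x).E310 = (𝔈 x).E310 ∧
      (opsYNuStOfRecordV11E N θ Mstar 𝔮 𝔮s h𝔮 h𝔮s 𝔯 𝔢 𝔴 𝔈 x).PosDef = (𝔈 x).PosDef ∧
      (opsYNuStOfRecordV11E N θ Mstar 𝔮 𝔮s h𝔮 h𝔮s 𝔯 𝔢 𝔴 𝔈 x).HasRWExp = (𝔈 x).HasRWExp ∧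
      (opsYNuStOfRecordV11E N θ Mstar 𝔮 𝔮s h𝔮 h𝔮s 𝔯 𝔢 𝔴 𝔈 x).HasRWExpH = (𝔈 x).HasRWExpH ∧
      (opsYNuStOfRecordV11E N θ Mstar 𝔮 𝔮s h𝔮 h𝔮s 𝔯 𝔢 𝔴 𝔈 x).PosDefK = (𝔈 x).PosDefK ∧
      (opsYStOfRecordV11E N θ Mstar 𝔮 𝔮s h𝔮 h𝔮s 𝔯 𝔢 𝔴 𝔈 x).IsAnalyticExt = (𝔈 x).IsAnalyticExt ∧
      (opsYStOfRecordV11E N θ Mstar 𝔮 𝔮s h𝔮 h𝔮s 𝔯 𝔢 𝔴 𝔈 x).E37 = (𝔈 x).E37 ∧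
      (opsYStOfRecordV11E N θ Mstar 𝔮 𝔮s h𝔮 h𝔮s 𝔯 𝔢 𝔴 𝔈 x).EK39 = (𝔈 x).EK39 ∧
      (opsYStOfRecordV11E N θ Mstar 𝔮 𝔮s h𝔮 h𝔮s 𝔯 𝔢 𝔴 𝔈 x).E310 = (𝔈 x).E310 ∧
      (opsYStOfRecordV11E N θ Mstar 𝔮 𝔮s h𝔮 h𝔮s 𝔯 𝔢 𝔴 𝔈 x).PosDef = (𝔈 x).PosDef ∧
      (opsYStOfRecordV11E N θ Mstar 𝔮 𝔮s h𝔮 h𝔮s 𝔯 𝔢 𝔴 𝔈 x).HasRWExp = (𝔈 x).HasRWExp ∧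
      (opsYStOfRecordV11E N θ Mstar 𝔮 𝔮s h𝔮 h𝔮s 𝔯 𝔢 𝔴 𝔈 x).HasRWExpH = (𝔈 x).HasRWExpH ∧
      (opsYStOfRecordV11E N θ Mstar 𝔮 𝔮s h𝔮 h𝔮s 𝔯 𝔢 𝔴 𝔈 x).PosDefK = (𝔈 x).PosDefK :=
  ⟨rfl, rfl, rfl, rfl, rfl, rfl, rfl, rfl, rfl, rfl, rfl, rfl, rfl, rfl, rfl, rfl⟩

/-- the [B9] bundle of record at the `ν`-read v11 star instance. [cite: Balaban1985BackgroundPropagators, Thms 3.1–3.15 pp.397–432, bookkeeping] -/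
theorem Y9OfRecord_opsYNuStOfRecordV11E :
    Y9OfRecord N θ Mstar (opsYNuStOfRecordV11E N θ Mstar 𝔮 𝔮s h𝔮 h𝔮s 𝔯 𝔢 𝔴 𝔈) =
      carriersY θ.d₆ θ.ℓ₆ θ.hd' θ.hL' θ.b₀ θ.b₁ Mstar (Matrix (Fin N) (Fin N) ℂ) (specialUnitaryUnits (Fin N))
        (opsYNuStOfRecordV11E N θ Mstar 𝔮 𝔮s h𝔮 h𝔮s 𝔯 𝔢 𝔴 𝔈) := rfl

/-- the [B9] bundle of record at the plain v11 star instance. [cite: Balaban1985BackgroundPropagators, Thms 3.1–3.15 pp.397–432, bookkeeping] -/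
theorem Y9OfRecord_opsYStOfRecordV11E :
    Y9OfRecord N θ Mstar (opsYStOfRecordV11E N θ Mstar 𝔮 𝔮s h𝔮 h𝔮s 𝔯 𝔢 𝔴 𝔈) =
      carriersY θ.d₆ θ.ℓ₆ θ.hd' θ.hL' θ.b₀ θ.b₁ Mstar (Matrix (Fin N) (Fin N) ℂ) (specialUnitaryUnits (Fin N))
        (opsYStOfRecordV11E N θ Mstar 𝔮 𝔮s h𝔮 h𝔮s 𝔯 𝔢 𝔴 𝔈) := rfl

/-- at the FLAT star Sect. E family the `ν`-read v11 star instance's `Ck` kernel vanishes identically (row 24's honesty guard, first half).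
[cite: Balaban1985BackgroundPropagators, Thm 3.15 (3.187) p.432, bookkeeping] -/
theorem opsYNuStOfRecordV11E_Ck_ker_flat (x : MemberY θ.d₆ θ.ℓ₆ θ.hd' θ.hL' θ.b₀ θ.b₁ Mstar)
    (U : (bg9Y (Matrix (Fin N) (Fin N) ℂ) (specialUnitaryUnits (Fin N)) x).Cfg) (y y' : (geo9Y x).Site) :
    (opsYNuStOfRecordV11E N θ Mstar 𝔮 𝔮s h𝔮 h𝔮s 𝔯 (sectEStY_flat N θ Mstar) 𝔴 𝔈 x).Ck.ker U y y' = 0 :=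
  operatorLayerYSectESt_Ck_ker_flat x (opsYS349NuOfLetters N θ Mstar (lettersYOfRecordV11 N θ Mstar 𝔮 𝔮s h𝔮 h𝔮s 𝔯) 𝔈 x)
    (lettersYOfRecordV11 N θ Mstar 𝔮 𝔮s h𝔮 h𝔮s 𝔯 x) (𝔴 x) U y y'

/-- at the FLAT star Sect. E family the plain v11 star instance's `Ck` kernel vanishes identically. [cite: Balaban1985BackgroundPropagators, Thm 3.15 (3.187) p.432, bookkeeping] -/
theorem opsYStOfRecordV11E_Ck_ker_flat (x : MemberY θ.d₆ θ.ℓ₆ θ.hd' θ.hL' θ.b₀ θ.b₁ Mstar)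
    (U : (bg9Y (Matrix (Fin N) (Fin N) ℂ) (specialUnitaryUnits (Fin N)) x).Cfg) (y y' : (geo9Y x).Site) :
    (opsYStOfRecordV11E N θ Mstar 𝔮 𝔮s h𝔮 h𝔮s 𝔯 (sectEStY_flat N θ Mstar) 𝔴 𝔈 x).Ck.ker U y y' = 0 :=
  operatorLayerYSectESt_Ck_ker_flat x (opsYS349OfLetters N θ Mstar (lettersYOfRecordV11 N θ Mstar 𝔮 𝔮s h𝔮 h𝔮s 𝔯) 𝔈 x)
    (lettersYOfRecordV11 N θ Mstar 𝔮 𝔮s h𝔮 h𝔮s 𝔯 x) (𝔴 x) U y y'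

/-- ★ **ROW 24 (`t315`) AT THE `ν`-READ v11 STAR INSTANCE, UNFOLDED** (`Iff.rfl`) — the named binder a certificate displays for row 24: the printed Theorem 3.15
about the index-bond kernel of the STAR `C^{(k)}(Λ; U) = CkStY` over the v11 letters of record and the star letters `𝔢`, «given by (3.185)» = `givenBy3185stY`,
the expansion clause = `hasRWExpCY (𝔴 x)`. [cite: Balaban1985BackgroundPropagators, Thm 3.15 (3.185)–(3.187) p.432] -/
theorem t315_opsYNuStOfRecordV11E_iff :
    B9.Thm315FullPrinted c35Y geo9Y (bg9Y (Matrix (Fin N) (Fin N) ℂ) (specialUnitaryUnits (Fin N)))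
        (fun x => (opsYNuStOfRecordV11E N θ Mstar 𝔮 𝔮s h𝔮 h𝔮s 𝔯 𝔢 𝔴 𝔈 x).Ck) inΛY unitDistY
        (fun x => (opsYNuStOfRecordV11E N θ Mstar 𝔮 𝔮s h𝔮 h𝔮s 𝔯 𝔢 𝔴 𝔈 x).GivenBy3185)
        (fun x => (opsYNuStOfRecordV11E N θ Mstar 𝔮 𝔮s h𝔮 h𝔮s 𝔯 𝔢 𝔴 𝔈 x).HasRWExpC) ↔
      B9.Thm315FullPrinted c35Y geo9Y (bg9Y (Matrix (Fin N) (Fin N) ℂ) (specialUnitaryUnits (Fin N)))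
        (fun x => siteKernelOfOp x.toKIdx (bg9Y (Matrix (Fin N) (Fin N) ℂ) (specialUnitaryUnits (Fin N)) x) (fun U => U)
          (CkStY x (lettersYOfRecordV11 N θ Mstar 𝔮 𝔮s h𝔮 h𝔮s 𝔯 x) (𝔢 x)) id id) inΛY unitDistY
        (fun x => givenBy3185stY x (lettersYOfRecordV11 N θ Mstar 𝔮 𝔮s h𝔮 h𝔮s 𝔯 x) (𝔢 x)) (fun x => hasRWExpCY (𝔴 x)) := Iff.rfl

/-- ROW 24 (`t315`) at the plain v11 star instance, unfolded (`Iff.rfl`). [cite: Balaban1985BackgroundPropagators, Thm 3.15 (3.185)–(3.187) p.432] -/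
theorem t315_opsYStOfRecordV11E_iff :
    B9.Thm315FullPrinted c35Y geo9Y (bg9Y (Matrix (Fin N) (Fin N) ℂ) (specialUnitaryUnits (Fin N)))
        (fun x => (opsYStOfRecordV11E N θ Mstar 𝔮 𝔮s h𝔮 h𝔮s 𝔯 𝔢 𝔴 𝔈 x).Ck) inΛY unitDistY
        (fun x => (opsYStOfRecordV11E N θ Mstar 𝔮 𝔮s h𝔮 h𝔮s 𝔯 𝔢 𝔴 𝔈 x).GivenBy3185)
        (fun x => (opsYStOfRecordV11E N θ Mstar 𝔮 𝔮s h𝔮 h𝔮s 𝔯 𝔢 𝔴 𝔈 x).HasRWExpC) ↔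
      B9.Thm315FullPrinted c35Y geo9Y (bg9Y (Matrix (Fin N) (Fin N) ℂ) (specialUnitaryUnits (Fin N)))
        (fun x => siteKernelOfOp x.toKIdx (bg9Y (Matrix (Fin N) (Fin N) ℂ) (specialUnitaryUnits (Fin N)) x) (fun U => U)
          (CkStY x (lettersYOfRecordV11 N θ Mstar 𝔮 𝔮s h𝔮 h𝔮s 𝔯 x) (𝔢 x)) id id) inΛY unitDistY
        (fun x => givenBy3185stY x (lettersYOfRecordV11 N θ Mstar 𝔮 𝔮s h𝔮 h𝔮s 𝔯 x) (𝔢 x)) (fun x => hasRWExpCY (𝔴 x)) := Iff.rfl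

/-- ROW 24 at the plain v11 star instance IS row 24 at the `ν`-read one (the three Sect. E fields agree, `Iff.rfl`). [cite: Balaban1985BackgroundPropagators, Thm 3.15 p.432, bookkeeping] -/
theorem t315_opsYStOfRecordV11E_iff_nu :
    B9.Thm315FullPrinted c35Y geo9Y (bg9Y (Matrix (Fin N) (Fin N) ℂ) (specialUnitaryUnits (Fin N)))
        (fun x => (opsYStOfRecordV11E N θ Mstar 𝔮 𝔮s h𝔮 h𝔮s 𝔯 𝔢 𝔴 𝔈 x).Ck) inΛY unitDistY
        (fun x => (opsYStOfRecordV11E N θ Mstar 𝔮 𝔮s h𝔮 h𝔮s 𝔯 𝔢 𝔴 𝔈 x).GivenBy3185)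
        (fun x => (opsYStOfRecordV11E N θ Mstar 𝔮 𝔮s h𝔮 h𝔮s 𝔯 𝔢 𝔴 𝔈 x).HasRWExpC) ↔
      B9.Thm315FullPrinted c35Y geo9Y (bg9Y (Matrix (Fin N) (Fin N) ℂ) (specialUnitaryUnits (Fin N)))
        (fun x => (opsYNuStOfRecordV11E N θ Mstar 𝔮 𝔮s h𝔮 h𝔮s 𝔯 𝔢 𝔴 𝔈 x).Ck) inΛY unitDistY
        (fun x => (opsYNuStOfRecordV11E N θ Mstar 𝔮 𝔮s h𝔮 h𝔮s 𝔯 𝔢 𝔴 𝔈 x).GivenBy3185)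
        (fun x => (opsYNuStOfRecordV11E N θ Mstar 𝔮 𝔮s h𝔮 h𝔮s 𝔯 𝔢 𝔴 𝔈 x).HasRWExpC) := Iff.rfl

/-- THE HONESTY GUARD at v11: at the FLAT star Sect. E family and the FLAT walk letters row 24 holds OUTRIGHT at the `ν`-read v11 star instance (kernel `0`,
both slots trivially inhabited) — content enters exactly with GENUINE star letters, never by the typing alone. [cite: Balaban1985BackgroundPropagators, Thm 3.15 (3.185)–(3.187) p.432, bookkeeping] -/
theorem t315_opsYNuStOfRecordV11E_flat {δ₀ : ℝ} (hδ₀ : 0 < δ₀) :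
    B9.Thm315FullPrinted c35Y geo9Y (bg9Y (Matrix (Fin N) (Fin N) ℂ) (specialUnitaryUnits (Fin N)))
      (fun x => (opsYNuStOfRecordV11E N θ Mstar 𝔮 𝔮s h𝔮 h𝔮s 𝔯 (sectEStY_flat N θ Mstar) (rwEY_flat N θ Mstar) 𝔈 x).Ck) inΛY unitDistY
      (fun x => (opsYNuStOfRecordV11E N θ Mstar 𝔮 𝔮s h𝔮 h𝔮s 𝔯 (sectEStY_flat N θ Mstar) (rwEY_flat N θ Mstar) 𝔈 x).GivenBy3185)
      (fun x => (opsYNuStOfRecordV11E N θ Mstar 𝔮 𝔮s h𝔮 h𝔮s 𝔯 (sectEStY_flat N θ Mstar) (rwEY_flat N θ Mstar) 𝔈 x).HasRWExpC) :=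
  ⟨δ₀, 1, 1, hδ₀, one_pos, one_pos, fun x _ _ _ U _ _ =>
    ⟨givenBy3185stY_flat x _ U, hasRWExpCY_flat _ _ x U δ₀, fun y y' _ _ => by
      rw [opsYNuStOfRecordV11E_Ck_ker_flat, abs_zero]
      exact mul_nonneg zero_le_one (Real.exp_nonneg _)⟩⟩

/-- the honesty guard at the plain v11 star instance. [cite: Balaban1985BackgroundPropagators, Thm 3.15 (3.185)–(3.187) p.432, bookkeeping] -/
theorem t315_opsYStOfRecordV11E_flat {δ₀ : ℝ} (hδ₀ : 0 < δ₀) :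
    B9.Thm315FullPrinted c35Y geo9Y (bg9Y (Matrix (Fin N) (Fin N) ℂ) (specialUnitaryUnits (Fin N)))
      (fun x => (opsYStOfRecordV11E N θ Mstar 𝔮 𝔮s h𝔮 h𝔮s 𝔯 (sectEStY_flat N θ Mstar) (rwEY_flat N θ Mstar) 𝔈 x).Ck) inΛY unitDistY
      (fun x => (opsYStOfRecordV11E N θ Mstar 𝔮 𝔮s h𝔮 h𝔮s 𝔯 (sectEStY_flat N θ Mstar) (rwEY_flat N θ Mstar) 𝔈 x).GivenBy3185)
      (fun x => (opsYStOfRecordV11E N θ Mstar 𝔮 𝔮s h𝔮 h𝔮s 𝔯 (sectEStY_flat N θ Mstar) (rwEY_flat N θ Mstar) 𝔈 x).HasRWExpC) :=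
  (t315_opsYStOfRecordV11E_iff_nu N θ Mstar 𝔮 𝔮s h𝔮 h𝔮s 𝔯 _ _ 𝔈).2 (t315_opsYNuStOfRecordV11E_flat N θ Mstar 𝔮 𝔮s h𝔮 h𝔮s 𝔯 𝔈 hδ₀)

/-! ### Row 24 KEYED BY NAME to the v11 star instances at the v7 star record `sectEStYOfRecordV7 … 𝔢₀` (one-line instances of `B9Thm315SectEStarRepAtLettersR` §5) -/

variable (𝔢₀ : SectEY N θ Mstar)

/-- ★★★ **ROW 24 AT THE `ν`-READ v11 STAR RECORD `opsYNuStOfRecordV11E … 𝔯 (sectEStYOfRecordV7 … 𝔢₀) 𝔴 𝔈` OVER `bg9Y ∕ c35Y`** from the three displayed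
conjuncts `givenBy3185stY ∧ hasRWExpCY ∧ DecayMidOnStY` at the v11 letters of record, locality proved INSIDE the consumed lemma (this face keys it by name).
[cite: Balaban1985BackgroundPropagators, Thm 3.15 (3.185)–(3.187) p.432, (3.157) p.428] -/
theorem t315_opsYNuStOfRecordV11E_sectEStYOfRecordV7_of_3185_on {a₀ δ₁ B₁ : ℝ} (ha₀ : 0 < a₀) (hδ₁ : 0 < δ₁) (hB₁ : 0 < B₁)
    (h : ∀ (x : MemberY θ.d₆ θ.ℓ₆ θ.hd' θ.hL' θ.b₀ θ.b₁ Mstar) (α₀ : ℝ), 0 < α₀ → (geo9Y x).M * α₀ ≤ a₀ →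
      ∀ U : (bg9Y (Matrix (Fin N) (Fin N) ℂ) (specialUnitaryUnits (Fin N)) x).Cfg,
        (bg9Y (Matrix (Fin N) (Fin N) ℂ) (specialUnitaryUnits (Fin N)) x).Reg335 c35Y α₀ U →
        (bg9Y (Matrix (Fin N) (Fin N) ℂ) (specialUnitaryUnits (Fin N)) x).Reg336 c35Y α₀ U →
          givenBy3185stY x (lettersYOfRecordV11 N θ Mstar 𝔮 𝔮s h𝔮 h𝔮s 𝔯 x) (sectEStYOfRecordV7 N θ Mstar 𝔢₀ x) U ∧ hasRWExpCY (𝔴 x) U δ₁ ∧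
            DecayMidOnStY x (lettersYOfRecordV11 N θ Mstar 𝔮 𝔮s h𝔮 h𝔮s 𝔯 x) (sectEStYOfRecordV7 N θ Mstar 𝔢₀ x) B₁ U δ₁) :
    B9.Thm315FullPrinted c35Y geo9Y (bg9Y (Matrix (Fin N) (Fin N) ℂ) (specialUnitaryUnits (Fin N)))
      (fun x => (opsYNuStOfRecordV11E N θ Mstar 𝔮 𝔮s h𝔮 h𝔮s 𝔯 (sectEStYOfRecordV7 N θ Mstar 𝔢₀) 𝔴 𝔈 x).Ck) inΛY unitDistY
      (fun x => (opsYNuStOfRecordV11E N θ Mstar 𝔮 𝔮s h𝔮 h𝔮s 𝔯 (sectEStYOfRecordV7 N θ Mstar 𝔢₀) 𝔴 𝔈 x).GivenBy3185)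
      (fun x => (opsYNuStOfRecordV11E N θ Mstar 𝔮 𝔮s h𝔮 h𝔮s 𝔯 (sectEStYOfRecordV7 N θ Mstar 𝔢₀) 𝔴 𝔈 x).HasRWExpC) :=
  t315_opsYSectESt_sectEStYOfRecordV7_of_3185_on N θ Mstar 𝔢₀
    (opsYS349NuOfLetters N θ Mstar (lettersYOfRecordV11 N θ Mstar 𝔮 𝔮s h𝔮 h𝔮s 𝔯) 𝔈) (lettersYOfRecordV11 N θ Mstar 𝔮 𝔮s h𝔮 h𝔮s 𝔯) 𝔴 ha₀ hδ₁ hB₁ h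

variable {R₁ R₂ : RegFamY θ.d₆ θ.ℓ₆ θ.hd' θ.hL' θ.b₀ θ.b₁ Mstar (Matrix (Fin N) (Fin N) ℂ)}

/-- ★★★ **ROW 24 AT THE `ν`-READ v11 STAR RECORD OVER THE CLASS-PARAMETRIC CARRIER `bg9YR … R₁ R₂` AT GENERIC `c`** (special-unitary member family `hGR`)
from the three displayed conjuncts, locality proved INSIDE the consumed lemma (this face keys it by name) — the v11 twin, keyed by name, of the N06 certificate of record's `have t315 := …_onR …` step.
[cite: Balaban1985BackgroundPropagators, Thm 3.15 (3.185)–(3.187) p.432, (3.157) p.428, (3.35)–(3.36) p.396; Balaban1984PropagatorsII, (2.3) p.224] -/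
theorem t315_opsYNuStOfRecordV11E_sectEStYOfRecordV7_of_3185_onR (hGR : MemOfFam (specialUnitaryUnits (Fin N)) R₁) {c a₀ δ₁ B₁ : ℝ}
    (ha₀ : 0 < a₀) (hδ₁ : 0 < δ₁) (hB₁ : 0 < B₁)
    (h : ∀ (x : MemberY θ.d₆ θ.ℓ₆ θ.hd' θ.hL' θ.b₀ θ.b₁ Mstar) (α₀ : ℝ), 0 < α₀ → (geo9Y x).M * α₀ ≤ a₀ →
      ∀ U : (bg9YR (Matrix (Fin N) (Fin N) ℂ) (specialUnitaryUnits (Fin N)) R₁ R₂ x).Cfg,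
        (bg9YR (Matrix (Fin N) (Fin N) ℂ) (specialUnitaryUnits (Fin N)) R₁ R₂ x).Reg335 c α₀ U →
        (bg9YR (Matrix (Fin N) (Fin N) ℂ) (specialUnitaryUnits (Fin N)) R₁ R₂ x).Reg336 c α₀ U →
          givenBy3185stY x (lettersYOfRecordV11 N θ Mstar 𝔮 𝔮s h𝔮 h𝔮s 𝔯 x) (sectEStYOfRecordV7 N θ Mstar 𝔢₀ x) U ∧ hasRWExpCY (𝔴 x) U δ₁ ∧
            DecayMidOnStY x (lettersYOfRecordV11 N θ Mstar 𝔮 𝔮s h𝔮 h𝔮s 𝔯 x) (sectEStYOfRecordV7 N θ Mstar 𝔢₀ x) B₁ U δ₁) :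
    B9.Thm315FullPrinted c geo9Y (bg9YR (Matrix (Fin N) (Fin N) ℂ) (specialUnitaryUnits (Fin N)) R₁ R₂)
      (fun x => siteKernelR R₁ R₂ (opsYNuStOfRecordV11E N θ Mstar 𝔮 𝔮s h𝔮 h𝔮s 𝔯 (sectEStYOfRecordV7 N θ Mstar 𝔢₀) 𝔴 𝔈 x).Ck) inΛY unitDistY
      (fun x => (opsYNuStOfRecordV11E N θ Mstar 𝔮 𝔮s h𝔮 h𝔮s 𝔯 (sectEStYOfRecordV7 N θ Mstar 𝔢₀) 𝔴 𝔈 x).GivenBy3185)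
      (fun x => (opsYNuStOfRecordV11E N θ Mstar 𝔮 𝔮s h𝔮 h𝔮s 𝔯 (sectEStYOfRecordV7 N θ Mstar 𝔢₀) 𝔴 𝔈 x).HasRWExpC) :=
  t315_opsYSectESt_sectEStYOfRecordV7_of_3185_onR N θ Mstar 𝔢₀ hGR
    (opsYS349NuOfLetters N θ Mstar (lettersYOfRecordV11 N θ Mstar 𝔮 𝔮s h𝔮 h𝔮s 𝔯) 𝔈) (lettersYOfRecordV11 N θ Mstar 𝔮 𝔮s h𝔮 h𝔮s 𝔯) 𝔴 ha₀ hδ₁ hB₁ h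

/-- ★★ the same over the class-parametric carrier at the PLAIN v11 star record (row 24 does not see rows 25–26).
[cite: Balaban1985BackgroundPropagators, Thm 3.15 (3.185)–(3.187) p.432, (3.157) p.428, (3.35)–(3.36) p.396] -/
theorem t315_opsYStOfRecordV11E_sectEStYOfRecordV7_of_3185_onR (hGR : MemOfFam (specialUnitaryUnits (Fin N)) R₁) {c a₀ δ₁ B₁ : ℝ}
    (ha₀ : 0 < a₀) (hδ₁ : 0 < δ₁) (hB₁ : 0 < B₁)
    (h : ∀ (x : MemberY θ.d₆ θ.ℓ₆ θ.hd' θ.hL' θ.b₀ θ.b₁ Mstar) (α₀ : ℝ), 0 < α₀ → (geo9Y x).M * α₀ ≤ a₀ →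
      ∀ U : (bg9YR (Matrix (Fin N) (Fin N) ℂ) (specialUnitaryUnits (Fin N)) R₁ R₂ x).Cfg,
        (bg9YR (Matrix (Fin N) (Fin N) ℂ) (specialUnitaryUnits (Fin N)) R₁ R₂ x).Reg335 c α₀ U →
        (bg9YR (Matrix (Fin N) (Fin N) ℂ) (specialUnitaryUnits (Fin N)) R₁ R₂ x).Reg336 c α₀ U →
          givenBy3185stY x (lettersYOfRecordV11 N θ Mstar 𝔮 𝔮s h𝔮 h𝔮s 𝔯 x) (sectEStYOfRecordV7 N θ Mstar 𝔢₀ x) U ∧ hasRWExpCY (𝔴 x) U δ₁ ∧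
            DecayMidOnStY x (lettersYOfRecordV11 N θ Mstar 𝔮 𝔮s h𝔮 h𝔮s 𝔯 x) (sectEStYOfRecordV7 N θ Mstar 𝔢₀ x) B₁ U δ₁) :
    B9.Thm315FullPrinted c geo9Y (bg9YR (Matrix (Fin N) (Fin N) ℂ) (specialUnitaryUnits (Fin N)) R₁ R₂)
      (fun x => siteKernelR R₁ R₂ (opsYStOfRecordV11E N θ Mstar 𝔮 𝔮s h𝔮 h𝔮s 𝔯 (sectEStYOfRecordV7 N θ Mstar 𝔢₀) 𝔴 𝔈 x).Ck) inΛY unitDistY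
      (fun x => (opsYStOfRecordV11E N θ Mstar 𝔮 𝔮s h𝔮 h𝔮s 𝔯 (sectEStYOfRecordV7 N θ Mstar 𝔢₀) 𝔴 𝔈 x).GivenBy3185)
      (fun x => (opsYStOfRecordV11E N θ Mstar 𝔮 𝔮s h𝔮 h𝔮s 𝔯 (sectEStYOfRecordV7 N θ Mstar 𝔢₀) 𝔴 𝔈 x).HasRWExpC) :=
  t315_opsYSectESt_sectEStYOfRecordV7_of_3185_onR N θ Mstar 𝔢₀ hGR
    (opsYS349OfLetters N θ Mstar (lettersYOfRecordV11 N θ Mstar 𝔮 𝔮s h𝔮 h𝔮s 𝔯) 𝔈) (lettersYOfRecordV11 N θ Mstar 𝔮 𝔮s h𝔮 h𝔮s 𝔯) 𝔴 ha₀ hδ₁ hB₁ h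

end Record

/-! ## §4 ★★★ THE KNIT-PAIR INSTANCES OF RECORD OVER THE KNIT TRANSPORTER: `lettersYOfRecordV11K`, `opsYStOfRecordV11KE ∕ opsYNuStOfRecordV11KE` -/

section RecordKnit

open scoped Matrix.Norms.L2Operator

/-- ★★★ **THE KNIT LETTERS OF RECORD** `:=` the v11 letters of record (knit-KEYED base chain) at the knit pair `(qKnitOfRecord, qsKnitOfRecord)` — print's `Q` of (3.115) in all nine
`Q`-dependent letters. [cite: Balaban1985BackgroundPropagators, (3.115) p.418, (3.122)–(3.132) pp.420–422, (3.153) p.426] [cite: Balaban1985Averaging, (15)–(23) pp.19–21] -/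
def lettersYOfRecordV11K (N : ℕ) [Nonempty (Fin N)] (θ : Stage3Params) (Mstar : ℕ) (𝔯 : ResY N θ Mstar) : LettersY N θ Mstar :=
  lettersYOfRecordV11 N θ Mstar (qKnitOfRecord N θ) (qsKnitOfRecord N θ) (qKnitOfRecord_flat N θ) (qsKnitOfRecord_flat N θ) 𝔯

/-- ★★★ **THE PLAIN v11 STAR INSTANCE OF RECORD AT THE KNIT PAIR.** [cite: Balaban1985BackgroundPropagators, Thms 3.1–3.15 pp.397–432, (3.115) p.418] [cite: Balaban1985Averaging, (15) p.19] -/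
def opsYStOfRecordV11KE (N : ℕ) [Nonempty (Fin N)] (θ : Stage3Params) (Mstar : ℕ) (𝔯 : ResY N θ Mstar) (𝔢 : SectEStY N θ Mstar)
    (𝔴 : RWEY N θ Mstar) (𝔈 : ExpsY N θ Mstar) : OpsY N θ Mstar :=
  opsYStOfRecordV11E N θ Mstar (qKnitOfRecord N θ) (qsKnitOfRecord N θ) (qKnitOfRecord_flat N θ) (qsKnitOfRecord_flat N θ) 𝔯 𝔢 𝔴 𝔈

/-- ★★★ **THE `ν`-READ v11 STAR INSTANCE OF RECORD AT THE KNIT PAIR** — the candidate object of a re-pinned N06 certificate (print's `Q` of (3.115) behind rows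
17, 20–26). [cite: Balaban1985BackgroundPropagators, Thms 3.1–3.15 pp.397–432, (3.115) p.418, (3.132) p.422] [cite: Balaban1985Averaging, (15) p.19] -/
def opsYNuStOfRecordV11KE (N : ℕ) [Nonempty (Fin N)] (θ : Stage3Params) (Mstar : ℕ) (𝔯 : ResY N θ Mstar) (𝔢 : SectEStY N θ Mstar)
    (𝔴 : RWEY N θ Mstar) (𝔈 : ExpsY N θ Mstar) : OpsY N θ Mstar :=
  opsYNuStOfRecordV11E N θ Mstar (qKnitOfRecord N θ) (qsKnitOfRecord N θ) (qKnitOfRecord_flat N θ) (qsKnitOfRecord_flat N θ) 𝔯 𝔢 𝔴 𝔈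

variable (N : ℕ) [Nonempty (Fin N)] (θ : Stage3Params) (Mstar : ℕ) (𝔯 : ResY N θ Mstar) (𝔢 : SectEStY N θ Mstar) (𝔴 : RWEY N θ Mstar)
  (𝔈 : ExpsY N θ Mstar)

/-- the knit letters of record ARE the v11 letters at the knit pair (`rfl`; every `lettersYOfRecordV11_…` face applies after this rewrite).
[cite: Balaban1985BackgroundPropagators, (3.115) p.418, bookkeeping] -/
theorem lettersYOfRecordV11K_eq : lettersYOfRecordV11K N θ Mstar 𝔯 =
    lettersYOfRecordV11 N θ Mstar (qKnitOfRecord N θ) (qsKnitOfRecord N θ) (qKnitOfRecord_flat N θ) (qsKnitOfRecord_flat N θ) 𝔯 := rfl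

/-- the plain knit instance IS the v11 instance at the knit pair (`rfl`; every `opsYStOfRecordV11E_…` face applies after this rewrite).
[cite: Balaban1985BackgroundPropagators, (3.115) p.418, Thm 3.15 p.432, bookkeeping] -/
theorem opsYStOfRecordV11KE_eq : opsYStOfRecordV11KE N θ Mstar 𝔯 𝔢 𝔴 𝔈 =
    opsYStOfRecordV11E N θ Mstar (qKnitOfRecord N θ) (qsKnitOfRecord N θ) (qKnitOfRecord_flat N θ) (qsKnitOfRecord_flat N θ) 𝔯 𝔢 𝔴 𝔈 := rfl

/-- the `ν`-read knit instance IS the v11 instance at the knit pair (`rfl`; every `opsYNuStOfRecordV11E_…` face applies after this rewrite).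
[cite: Balaban1985BackgroundPropagators, (3.115) p.418, (3.132) p.422, Thm 3.15 p.432, bookkeeping] -/
theorem opsYNuStOfRecordV11KE_eq : opsYNuStOfRecordV11KE N θ Mstar 𝔯 𝔢 𝔴 𝔈 =
    opsYNuStOfRecordV11E N θ Mstar (qKnitOfRecord N θ) (qsKnitOfRecord N θ) (qKnitOfRecord_flat N θ) (qsKnitOfRecord_flat N θ) 𝔯 𝔢 𝔴 𝔈 := rfl

/-- the plain knit instance as the star constructor over the knit letters (`rfl`). [cite: Balaban1985BackgroundPropagators, Thm 3.15 p.432, bookkeeping] -/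
theorem opsYStOfRecordV11KE_eq_opsYSectESt : opsYStOfRecordV11KE N θ Mstar 𝔯 𝔢 𝔴 𝔈 =
    opsYSectESt N θ Mstar (opsYS349OfLetters N θ Mstar (lettersYOfRecordV11K N θ Mstar 𝔯) 𝔈) (lettersYOfRecordV11K N θ Mstar 𝔯) 𝔢 𝔴 := rfl

/-- the `ν`-read knit instance as the star constructor over the knit letters (`rfl`). [cite: Balaban1985BackgroundPropagators, Thm 3.15 p.432, (3.132) p.422, bookkeeping] -/
theorem opsYNuStOfRecordV11KE_eq_opsYSectESt : opsYNuStOfRecordV11KE N θ Mstar 𝔯 𝔢 𝔴 𝔈 =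
    opsYSectESt N θ Mstar (opsYS349NuOfLetters N θ Mstar (lettersYOfRecordV11K N θ Mstar 𝔯) 𝔈) (lettersYOfRecordV11K N θ Mstar 𝔯) 𝔢 𝔴 := rfl

/-- the knit letters of record at a member (`rfl`). [cite: Balaban1985BackgroundPropagators, (3.115) p.418, (3.122)–(3.132) pp.420–422, bookkeeping] -/
theorem lettersYOfRecordV11K_apply (x : MemberY θ.d₆ θ.ℓ₆ θ.hd' θ.hL' θ.b₀ θ.b₁ Mstar) :
    lettersYOfRecordV11K N θ Mstar 𝔯 x = covLettersY_v11 (Matrix (Fin N) (Fin N) ℂ) x (qKnitOfRecord N θ) (qsKnitOfRecord N θ)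
      (qKnitOfRecord_flat N θ x.toKIdx) (qsKnitOfRecord_flat N θ x.toKIdx) (𝔯 x) := rfl

/-- the pair-independent letters of the v11 knit record, by name (`parKnitY ∕ parBY ∕ GpY parKnitY ∕ CY`; pins = the v4P record's, `rfl`). [cite: Balaban1985BackgroundPropagators, (3.19) p.393, (3.24)–(3.25) p.394, (3.48) p.398, bookkeeping] -/
theorem lettersYOfRecordV11K_base (x : MemberY θ.d₆ θ.ℓ₆ θ.hd' θ.hL' θ.b₀ θ.b₁ Mstar) :
    (lettersYOfRecordV11K N θ Mstar 𝔯 x).parS = parKnitY x.toKIdx ∧ (lettersYOfRecordV11K N θ Mstar 𝔯 x).parB = parBY x.toKIdx ∧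
      (lettersYOfRecordV11K N θ Mstar 𝔯 x).Gp = GpY x.toKIdx (parKnitY x.toKIdx) ∧
      (lettersYOfRecordV11K N θ Mstar 𝔯 x).C = CY x.toKIdx (parKnitY x.toKIdx) (GpY x.toKIdx (parKnitY x.toKIdx)) ∧
      (lettersYOfRecordV11K N θ Mstar 𝔯 x).P349 = (lettersYOfRecordV4P N θ Mstar 𝔯 x).P349 ∧
      (lettersYOfRecordV11K N θ Mstar 𝔯 x).Ck = (lettersYOfRecordV4P N θ Mstar 𝔯 x).Ck := ⟨rfl, rfl, rfl, rfl, rfl, rfl⟩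

/-- ★ the Sect. B∕D∕E letters of the knit record, by name: the composites OVER THE KNIT PAIR `(QknitY, QknitY†)` fed `G′_phys`, and `GA` at lattice units.
[cite: Balaban1985BackgroundPropagators, (3.27) p.395, (3.115) p.418, (3.122)–(3.132) pp.420–422, (3.153) p.426] [cite: Balaban1985Averaging, (15) p.19] -/
theorem lettersYOfRecordV11K_sectDE (x : MemberY θ.d₆ θ.ℓ₆ θ.hd' θ.hL' θ.b₀ θ.b₁ Mstar) :
    (lettersYOfRecordV11K N θ Mstar 𝔯 x).GD =
        GDQY x.toKIdx (qKnitOfRecord N θ x.toKIdx) (qsKnitOfRecord N θ x.toKIdx) (parKnitY x.toKIdx) (GpPhysY x.toKIdx (parKnitY x.toKIdx)) ∧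
      (lettersYOfRecordV11K N θ Mstar 𝔯 x).QGQinv =
        QGQinvQY x.toKIdx (qKnitOfRecord N θ x.toKIdx) (qsKnitOfRecord N θ x.toKIdx) (parKnitY x.toKIdx) (GpPhysY x.toKIdx (parKnitY x.toKIdx)) ∧
      (lettersYOfRecordV11K N θ Mstar 𝔯 x).H =
        HDQY x.toKIdx (qKnitOfRecord N θ x.toKIdx) (qsKnitOfRecord N θ x.toKIdx) (parKnitY x.toKIdx) (GpPhysY x.toKIdx (parKnitY x.toKIdx)) ∧
      (lettersYOfRecordV11K N θ Mstar 𝔯 x).G₁ =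
        G1QY x.toKIdx (qKnitOfRecord N θ x.toKIdx) (qsKnitOfRecord N θ x.toKIdx) (parKnitY x.toKIdx) (GpPhysY x.toKIdx (parKnitY x.toKIdx))
          (𝔯 x).Δ2 ∧
      (lettersYOfRecordV11K N θ Mstar 𝔯 x).QG1Qinv =
        QG1QinvQY x.toKIdx (qKnitOfRecord N θ x.toKIdx) (qsKnitOfRecord N θ x.toKIdx) (parKnitY x.toKIdx) (GpPhysY x.toKIdx (parKnitY x.toKIdx))
          (𝔯 x).Δ2 ∧
      (lettersYOfRecordV11K N θ Mstar 𝔯 x).H₁ =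
        H1QY x.toKIdx (qKnitOfRecord N θ x.toKIdx) (qsKnitOfRecord N θ x.toKIdx) (parKnitY x.toKIdx) (GpPhysY x.toKIdx (parKnitY x.toKIdx))
          (𝔯 x).Δ2 ∧
      (lettersYOfRecordV11K N θ Mstar 𝔯 x).GG =
        GGQY x.toKIdx (qKnitOfRecord N θ x.toKIdx) (qsKnitOfRecord N θ x.toKIdx) (parKnitY x.toKIdx) (GpPhysY x.toKIdx (parKnitY x.toKIdx))
          (𝔯 x).Δ2 ∧
      (lettersYOfRecordV11K N θ Mstar 𝔯 x).GA =
        GAQY x.toKIdx (qKnitOfRecord N θ x.toKIdx) (qsKnitOfRecord N θ x.toKIdx) (parKnitY x.toKIdx) (GpY x.toKIdx (parKnitY x.toKIdx)) :=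
  ⟨rfl, rfl, rfl, rfl, rfl, rfl, rfl, rfl⟩

/-- ★ the knit record's `GA` is ALSO the composite fed `G′_phys`. [cite: Balaban1985BackgroundPropagators, (3.26)–(3.27) p.395, (3.25) p.394] -/
theorem lettersYOfRecordV11K_GA_phys (x : MemberY θ.d₆ θ.ℓ₆ θ.hd' θ.hL' θ.b₀ θ.b₁ Mstar) :
    (lettersYOfRecordV11K N θ Mstar 𝔯 x).GA =
      GAQY x.toKIdx (qKnitOfRecord N θ x.toKIdx) (qsKnitOfRecord N θ x.toKIdx) (parKnitY x.toKIdx) (GpPhysY x.toKIdx (parKnitY x.toKIdx)) :=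
  lettersYOfRecordV11_GA_phys N θ Mstar (qKnitOfRecord N θ) (qsKnitOfRecord N θ) (qKnitOfRecord_flat N θ) (qsKnitOfRecord_flat N θ) 𝔯 x

variable {G : Subgroup (Matrix (Fin N) (Fin N) ℂ)ˣ}

/-- ★★★ **THE v11 KNIT RECORD'S `GD` IS SYMMETRIC AT EVERY `G`-VALUED CONFIGURATION WITH `G`-VALUED KNIT LEGS, `G ≤ U(N)`** — no pair hypothesis (the knit pair is
adjoint by construction); on the regime of record see `lettersYOfRecordV11K_GD_isSymmTr_of_regQY`.
[cite: Balaban1985BackgroundPropagators, (3.122)–(3.123) p.420, (3.35) p.396] [cite: Balaban1985Averaging, (15) p.19] -/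
theorem lettersYOfRecordV11K_GD_isSymmTr (hG : G ≤ B7Prop2Explicit.unitaryUnits (Matrix (Fin N) (Fin N) ℂ))
    (x : MemberY θ.d₆ θ.ℓ₆ θ.hd' θ.hL' θ.b₀ θ.b₁ Mstar) {U : CfgY (Matrix (Fin N) (Fin N) ℂ) x.toKIdx} (hU : ∀ μ z, U μ z ∈ G)
    (hpar : ∀ z w : SiteY x.toKIdx, parKnitY x.toKIdx U z w ∈ G) : IsSymmTr (fun _ => (1 : ℝ)) ((lettersYOfRecordV11K N θ Mstar 𝔯 x).GD U) :=
  lettersYOfRecordV11_GD_isSymmTr N θ Mstar (qKnitOfRecord N θ) (qsKnitOfRecord N θ) (qKnitOfRecord_flat N θ) (qsKnitOfRecord_flat N θ) 𝔯 hG x hU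
    hpar (isAdjTr_qKnitOfRecord x.toKIdx U)

/-- ★★ **ON THE REGIME OF RECORD `regQY G x.toKIdx c₀ α₀` THE v11 KNIT RECORD'S `GD` IS SYMMETRIC OUTRIGHT** (`G ≤ U(N)` unit-bounded, `c₀ ≤ 10`, `0 ≤ Mα₀`, the
x-free numerics): the knit legs are unitary there (`parKnitY_mem_unitary_of_regQY`), take `G := U(N)`.
[cite: Balaban1985BackgroundPropagators, (3.122)–(3.123) p.420, (3.35) p.396] [cite: Balaban1985Averaging, Prop. 2 p.26, (15) p.19] -/
theorem lettersYOfRecordV11K_GD_isSymmTr_of_regQY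
    (hG1 : ∀ u : (Matrix (Fin N) (Fin N) ℂ)ˣ, u ∈ G → ‖(u : Matrix (Fin N) (Fin N) ℂ)‖ ≤ 1) (hGU : G ≤ B7Prop2Explicit.unitaryUnits (Matrix (Fin N) (Fin N) ℂ))
    {c₀ α₀ : ℝ} (hc : c₀ ≤ 10) (x : MemberY θ.d₆ θ.ℓ₆ θ.hd' θ.hL' θ.b₀ θ.b₁ Mstar) (hMα : 0 ≤ (kGeo x.toKIdx).M * α₀) {α₀' : ℝ} (hα' : 0 < α₀')
    (hα3 : C0 (θ.d₆ + 1) * α₀' ≤ 1 / 3) (hα2 : 2 * α₀' ≤ c2' (θ.d₆ + 1) (θ.ℓ₆ + 1)) (hK : Kpl x.toKIdx ((kGeo x.toKIdx).M * α₀) * (kGeo x.toKIdx).L ^ 4 < α₀')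
    {U : CfgY (Matrix (Fin N) (Fin N) ℂ) x.toKIdx} (hU : regQY G x.toKIdx c₀ α₀ U) : IsSymmTr (fun _ => (1 : ℝ)) ((lettersYOfRecordV11K N θ Mstar 𝔯 x).GD U) :=
  lettersYOfRecordV11K_GD_isSymmTr N θ Mstar 𝔯 (G := B7Prop2Explicit.unitaryUnits _) le_rfl x (fun μ z => hGU (mem_of_regQY (i := x.toKIdx) hU μ z))
    (parKnitY_mem_unitary_of_regQY x.toKIdx hG1 hGU hc hMα hα' hα3 hα2 hK hU)

/-- ★★★ **THE CERTIFICATE's `hsymD` AT THE v11 KNIT RECORD** (`GD ∧ G₁ ∧ GG` symmetric at special-unitary configurations) from two displayed hypotheses: the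
knit legs unitary at those configurations (`hpar`) and a symmetric residual family — the adjointness of the knit pair DISCHARGED. [cite: Balaban1985BackgroundPropagators, (3.122) p.420, (3.128) p.421, (3.153) p.426, (3.35) p.396] [cite: Balaban1985Averaging, (15) p.19] -/
theorem lettersYOfRecordV11K_symmDG₁GG
    (hpar : ∀ (x : MemberY θ.d₆ θ.ℓ₆ θ.hd' θ.hL' θ.b₀ θ.b₁ Mstar) (U : CfgY (Matrix (Fin N) (Fin N) ℂ) x.toKIdx), (∀ μ z, U μ z ∈ specialUnitaryUnits (Fin N)) →
      ∀ z w : SiteY x.toKIdx, parKnitY x.toKIdx U z w ∈ B7Prop2Explicit.unitaryUnits (Matrix (Fin N) (Fin N) ℂ))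
    (hΔ2 : ∀ (x : MemberY θ.d₆ θ.ℓ₆ θ.hd' θ.hL' θ.b₀ θ.b₁ Mstar) (U : CfgY (Matrix (Fin N) (Fin N) ℂ) x.toKIdx), (∀ μ z, U μ z ∈ specialUnitaryUnits (Fin N)) →
      IsSymmTr (fun _ => (1 : ℝ)) ((𝔯 x).Δ2 U)) :
    ∀ (x : MemberY θ.d₆ θ.ℓ₆ θ.hd' θ.hL' θ.b₀ θ.b₁ Mstar) (U : CfgY (Matrix (Fin N) (Fin N) ℂ) x.toKIdx), (∀ μ z, U μ z ∈ specialUnitaryUnits (Fin N)) →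
      IsSymmTr (fun _ => (1 : ℝ)) ((lettersYOfRecordV11K N θ Mstar 𝔯 x).GD U) ∧ IsSymmTr (fun _ => (1 : ℝ)) ((lettersYOfRecordV11K N θ Mstar 𝔯 x).G₁ U) ∧
        IsSymmTr (fun _ => (1 : ℝ)) ((lettersYOfRecordV11K N θ Mstar 𝔯 x).GG U) :=
  lettersYOfRecordV11_symmDG₁GG N θ Mstar (qKnitOfRecord N θ) (qsKnitOfRecord N θ) (qKnitOfRecord_flat N θ) (qsKnitOfRecord_flat N θ) 𝔯
    (fun x U _ => isAdjTr_qKnitOfRecord x.toKIdx U) hpar hΔ2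

/-- ★★ **THE UNIT `(Q G₁ Q†)(U)` AT THE KNIT RECORD** from `Δ⁽¹⁾(U) > 0` and «`QknitY(U)` onto» (the certificate's `hUQ`; adjointness by construction).
[cite: Balaban1985BackgroundPropagators, (3.132) p.422, (3.128) p.421, (3.138) p.423] [cite: Balaban1985Averaging, (15) p.19] -/
theorem lettersYOfRecordV11K_isUnit_QGQOfQY_G₁ (x : MemberY θ.d₆ θ.ℓ₆ θ.hd' θ.hL' θ.b₀ θ.b₁ Mstar) {U : CfgY (Matrix (Fin N) (Fin N) ℂ) x.toKIdx}
    (hsurj : Function.Surjective (qKnitOfRecord N θ x.toKIdx U))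
    (hΔ1 : PosDefTr (fun _ => (1 : ℝ)) (deltaOneQY x.toKIdx (qKnitOfRecord N θ x.toKIdx) (qsKnitOfRecord N θ x.toKIdx) (parKnitY x.toKIdx)
      (GpPhysY x.toKIdx (parKnitY x.toKIdx)) (𝔯 x).Δ2 U)) :
    IsUnit (QGQOfQY x.toKIdx (qKnitOfRecord N θ x.toKIdx) (qsKnitOfRecord N θ x.toKIdx) (lettersYOfRecordV11K N θ Mstar 𝔯 x).G₁ U) :=
  lettersYOfRecordV11_isUnit_QGQOfQY_G₁_of_surjective N θ Mstar (qKnitOfRecord N θ) (qsKnitOfRecord N θ) (qKnitOfRecord_flat N θ)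
    (qsKnitOfRecord_flat N θ) 𝔯 x (isAdjTr_qKnitOfRecord x.toKIdx U) hsurj hΔ1

/-- ★ the same from the regime law (L2) «`Q(U)` onto on the regime `𝓡`» (`IsOntoOnQ`) at a configuration of the regime.
[cite: Balaban1985BackgroundPropagators, (3.132) p.422, (3.35) p.396] [cite: Balaban1985Averaging, (15) p.19] -/
theorem lettersYOfRecordV11K_isUnit_QGQOfQY_G₁_of_isOntoOnQ (x : MemberY θ.d₆ θ.ℓ₆ θ.hd' θ.hL' θ.b₀ θ.b₁ Mstar)
    {𝓡 : RegimeY (Matrix (Fin N) (Fin N) ℂ) x.toKIdx} (honto : IsOntoOnQ 𝓡 (qKnitOfRecord N θ x.toKIdx)) {U : CfgY (Matrix (Fin N) (Fin N) ℂ) x.toKIdx}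
    (hU : 𝓡 U)
    (hΔ1 : PosDefTr (fun _ => (1 : ℝ)) (deltaOneQY x.toKIdx (qKnitOfRecord N θ x.toKIdx) (qsKnitOfRecord N θ x.toKIdx) (parKnitY x.toKIdx)
      (GpPhysY x.toKIdx (parKnitY x.toKIdx)) (𝔯 x).Δ2 U)) :
    IsUnit (QGQOfQY x.toKIdx (qKnitOfRecord N θ x.toKIdx) (qsKnitOfRecord N θ x.toKIdx) (lettersYOfRecordV11K N θ Mstar 𝔯 x).G₁ U) :=
  lettersYOfRecordV11K_isUnit_QGQOfQY_G₁ N θ Mstar 𝔯 x (honto U hU) hΔ1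

/-- the [B9] bundle of record at the `ν`-read knit instance. [cite: Balaban1985BackgroundPropagators, Thms 3.1–3.15 pp.397–432, bookkeeping] -/
theorem Y9OfRecord_opsYNuStOfRecordV11KE :
    Y9OfRecord N θ Mstar (opsYNuStOfRecordV11KE N θ Mstar 𝔯 𝔢 𝔴 𝔈) =
      carriersY θ.d₆ θ.ℓ₆ θ.hd' θ.hL' θ.b₀ θ.b₁ Mstar (Matrix (Fin N) (Fin N) ℂ) (specialUnitaryUnits (Fin N)) (opsYNuStOfRecordV11KE N θ Mstar 𝔯 𝔢 𝔴 𝔈) :=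
  rfl

/-- the [B9] bundle of record at the plain knit instance. [cite: Balaban1985BackgroundPropagators, Thms 3.1–3.15 pp.397–432, bookkeeping] -/
theorem Y9OfRecord_opsYStOfRecordV11KE :
    Y9OfRecord N θ Mstar (opsYStOfRecordV11KE N θ Mstar 𝔯 𝔢 𝔴 𝔈) =
      carriersY θ.d₆ θ.ℓ₆ θ.hd' θ.hL' θ.b₀ θ.b₁ Mstar (Matrix (Fin N) (Fin N) ℂ) (specialUnitaryUnits (Fin N)) (opsYStOfRecordV11KE N θ Mstar 𝔯 𝔢 𝔴 𝔈) :=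
  rfl

/-- ★ ROWS 24–26 at the `ν`-read knit instance: `Ck` = the STAR `C^{(k)}(Λ; U)` over the KNIT letters of record, `GivenBy3185`, `HasRWExpC`, and row 26's two kernels =
the `ν`-readings of `(QG̃Q†)⁻¹ ∕ (QG₁Q†)⁻¹` OVER THE KNIT PAIR fed `G′_phys` (`rfl`). [cite: Balaban1985BackgroundPropagators, Thm 3.15 (3.185)–(3.187) p.432, (3.132) p.422, (3.157)–(3.158) p.428] [cite: Balaban1985Averaging, (15) p.19] -/
theorem opsYNuStOfRecordV11KE_sectE (x : MemberY θ.d₆ θ.ℓ₆ θ.hd' θ.hL' θ.b₀ θ.b₁ Mstar) :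
    (opsYNuStOfRecordV11KE N θ Mstar 𝔯 𝔢 𝔴 𝔈 x).Ck =
        siteKernelOfOp x.toKIdx (bg9Y (Matrix (Fin N) (Fin N) ℂ) (specialUnitaryUnits (Fin N)) x) (fun U => U)
          (CkStY x (lettersYOfRecordV11K N θ Mstar 𝔯 x) (𝔢 x)) id id ∧
      (opsYNuStOfRecordV11KE N θ Mstar 𝔯 𝔢 𝔴 𝔈 x).GivenBy3185 = givenBy3185stY x (lettersYOfRecordV11K N θ Mstar 𝔯 x) (𝔢 x) ∧
      (opsYNuStOfRecordV11KE N θ Mstar 𝔯 𝔢 𝔴 𝔈 x).HasRWExpC = hasRWExpCY (𝔴 x) ∧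
      (opsYNuStOfRecordV11KE N θ Mstar 𝔯 𝔢 𝔴 𝔈 x).QGQinv =
        siteKernelOfOpNu x.toKIdx (bg9Y (Matrix (Fin N) (Fin N) ℂ) (specialUnitaryUnits (Fin N)) x) (fun U => U) (nuY (θ.d₆ + 1) x.toKIdx)
          (QGQinvQY x.toKIdx (qKnitOfRecord N θ x.toKIdx) (qsKnitOfRecord N θ x.toKIdx) (parKnitY x.toKIdx) (GpPhysY x.toKIdx (parKnitY x.toKIdx))) ∧
      (opsYNuStOfRecordV11KE N θ Mstar 𝔯 𝔢 𝔴 𝔈 x).QG1Qinv =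
        siteKernelOfOpNu x.toKIdx (bg9Y (Matrix (Fin N) (Fin N) ℂ) (specialUnitaryUnits (Fin N)) x) (fun U => U) (nuY (θ.d₆ + 1) x.toKIdx)
          (QG1QinvQY x.toKIdx (qKnitOfRecord N θ x.toKIdx) (qsKnitOfRecord N θ x.toKIdx) (parKnitY x.toKIdx) (GpPhysY x.toKIdx (parKnitY x.toKIdx))
            (𝔯 x).Δ2) := ⟨rfl, rfl, rfl, rfl, rfl⟩

variable (𝔢₀ : SectEY N θ Mstar)

/-- ★★★ **ROW 24 AT THE `ν`-READ KNIT RECORD `opsYNuStOfRecordV11KE … 𝔯 (sectEStYOfRecordV7 … 𝔢₀) 𝔴 𝔈` OVER `bg9Y ∕ c35Y`** from the three displayed conjuncts at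
the knit letters of record, locality proved INSIDE the consumed lemma (this face keys it by name). [cite: Balaban1985BackgroundPropagators, Thm 3.15 (3.185)–(3.187) p.432, (3.157) p.428] [cite: Balaban1985Averaging, (15) p.19] -/
theorem t315_opsYNuStOfRecordV11KE_sectEStYOfRecordV7_of_3185_on {a₀ δ₁ B₁ : ℝ} (ha₀ : 0 < a₀) (hδ₁ : 0 < δ₁) (hB₁ : 0 < B₁)
    (h : ∀ (x : MemberY θ.d₆ θ.ℓ₆ θ.hd' θ.hL' θ.b₀ θ.b₁ Mstar) (α₀ : ℝ), 0 < α₀ → (geo9Y x).M * α₀ ≤ a₀ →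
      ∀ U : (bg9Y (Matrix (Fin N) (Fin N) ℂ) (specialUnitaryUnits (Fin N)) x).Cfg,
        (bg9Y (Matrix (Fin N) (Fin N) ℂ) (specialUnitaryUnits (Fin N)) x).Reg335 c35Y α₀ U →
        (bg9Y (Matrix (Fin N) (Fin N) ℂ) (specialUnitaryUnits (Fin N)) x).Reg336 c35Y α₀ U →
          givenBy3185stY x (lettersYOfRecordV11K N θ Mstar 𝔯 x) (sectEStYOfRecordV7 N θ Mstar 𝔢₀ x) U ∧ hasRWExpCY (𝔴 x) U δ₁ ∧
            DecayMidOnStY x (lettersYOfRecordV11K N θ Mstar 𝔯 x) (sectEStYOfRecordV7 N θ Mstar 𝔢₀ x) B₁ U δ₁) :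
    B9.Thm315FullPrinted c35Y geo9Y (bg9Y (Matrix (Fin N) (Fin N) ℂ) (specialUnitaryUnits (Fin N)))
      (fun x => (opsYNuStOfRecordV11KE N θ Mstar 𝔯 (sectEStYOfRecordV7 N θ Mstar 𝔢₀) 𝔴 𝔈 x).Ck) inΛY unitDistY
      (fun x => (opsYNuStOfRecordV11KE N θ Mstar 𝔯 (sectEStYOfRecordV7 N θ Mstar 𝔢₀) 𝔴 𝔈 x).GivenBy3185)
      (fun x => (opsYNuStOfRecordV11KE N θ Mstar 𝔯 (sectEStYOfRecordV7 N θ Mstar 𝔢₀) 𝔴 𝔈 x).HasRWExpC) :=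
  t315_opsYSectESt_sectEStYOfRecordV7_of_3185_on N θ Mstar 𝔢₀ (opsYS349NuOfLetters N θ Mstar (lettersYOfRecordV11K N θ Mstar 𝔯) 𝔈)
    (lettersYOfRecordV11K N θ Mstar 𝔯) 𝔴 ha₀ hδ₁ hB₁ h

variable {R₁ R₂ : RegFamY θ.d₆ θ.ℓ₆ θ.hd' θ.hL' θ.b₀ θ.b₁ Mstar (Matrix (Fin N) (Fin N) ℂ)}

/-- ★★★ **ROW 24 AT THE `ν`-READ KNIT RECORD OVER THE CLASS-PARAMETRIC CARRIER `bg9YR … R₁ R₂` AT GENERIC `c`** (special-unitary member family `hGR`) from the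
three displayed conjuncts at the knit letters of record, locality proved INSIDE the consumed lemma (this face keys it by name) — the knit twin of the certificate's `have t315 := …_onR …` step.
[cite: Balaban1985BackgroundPropagators, Thm 3.15 (3.185)–(3.187) p.432, (3.157) p.428, (3.35)–(3.36) p.396; Balaban1984PropagatorsII, (2.3) p.224] [cite: Balaban1985Averaging, (15) p.19] -/
theorem t315_opsYNuStOfRecordV11KE_sectEStYOfRecordV7_of_3185_onR (hGR : MemOfFam (specialUnitaryUnits (Fin N)) R₁) {c a₀ δ₁ B₁ : ℝ}
    (ha₀ : 0 < a₀) (hδ₁ : 0 < δ₁) (hB₁ : 0 < B₁)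
    (h : ∀ (x : MemberY θ.d₆ θ.ℓ₆ θ.hd' θ.hL' θ.b₀ θ.b₁ Mstar) (α₀ : ℝ), 0 < α₀ → (geo9Y x).M * α₀ ≤ a₀ →
      ∀ U : (bg9YR (Matrix (Fin N) (Fin N) ℂ) (specialUnitaryUnits (Fin N)) R₁ R₂ x).Cfg,
        (bg9YR (Matrix (Fin N) (Fin N) ℂ) (specialUnitaryUnits (Fin N)) R₁ R₂ x).Reg335 c α₀ U →
        (bg9YR (Matrix (Fin N) (Fin N) ℂ) (specialUnitaryUnits (Fin N)) R₁ R₂ x).Reg336 c α₀ U →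
          givenBy3185stY x (lettersYOfRecordV11K N θ Mstar 𝔯 x) (sectEStYOfRecordV7 N θ Mstar 𝔢₀ x) U ∧ hasRWExpCY (𝔴 x) U δ₁ ∧
            DecayMidOnStY x (lettersYOfRecordV11K N θ Mstar 𝔯 x) (sectEStYOfRecordV7 N θ Mstar 𝔢₀ x) B₁ U δ₁) :
    B9.Thm315FullPrinted c geo9Y (bg9YR (Matrix (Fin N) (Fin N) ℂ) (specialUnitaryUnits (Fin N)) R₁ R₂)
      (fun x => siteKernelR R₁ R₂ (opsYNuStOfRecordV11KE N θ Mstar 𝔯 (sectEStYOfRecordV7 N θ Mstar 𝔢₀) 𝔴 𝔈 x).Ck) inΛY unitDistY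
      (fun x => (opsYNuStOfRecordV11KE N θ Mstar 𝔯 (sectEStYOfRecordV7 N θ Mstar 𝔢₀) 𝔴 𝔈 x).GivenBy3185)
      (fun x => (opsYNuStOfRecordV11KE N θ Mstar 𝔯 (sectEStYOfRecordV7 N θ Mstar 𝔢₀) 𝔴 𝔈 x).HasRWExpC) :=
  t315_opsYSectESt_sectEStYOfRecordV7_of_3185_onR N θ Mstar 𝔢₀ hGR (opsYS349NuOfLetters N θ Mstar (lettersYOfRecordV11K N θ Mstar 𝔯) 𝔈)
    (lettersYOfRecordV11K N θ Mstar 𝔯) 𝔴 ha₀ hδ₁ hB₁ h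

/-- ★★ the same over the class-parametric carrier at the PLAIN knit record. [cite: Balaban1985BackgroundPropagators, Thm 3.15 (3.185)–(3.187) p.432, (3.157) p.428, (3.35)–(3.36) p.396] [cite: Balaban1985Averaging, (15) p.19] -/
theorem t315_opsYStOfRecordV11KE_sectEStYOfRecordV7_of_3185_onR (hGR : MemOfFam (specialUnitaryUnits (Fin N)) R₁) {c a₀ δ₁ B₁ : ℝ}
    (ha₀ : 0 < a₀) (hδ₁ : 0 < δ₁) (hB₁ : 0 < B₁)
    (h : ∀ (x : MemberY θ.d₆ θ.ℓ₆ θ.hd' θ.hL' θ.b₀ θ.b₁ Mstar) (α₀ : ℝ), 0 < α₀ → (geo9Y x).M * α₀ ≤ a₀ →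
      ∀ U : (bg9YR (Matrix (Fin N) (Fin N) ℂ) (specialUnitaryUnits (Fin N)) R₁ R₂ x).Cfg,
        (bg9YR (Matrix (Fin N) (Fin N) ℂ) (specialUnitaryUnits (Fin N)) R₁ R₂ x).Reg335 c α₀ U →
        (bg9YR (Matrix (Fin N) (Fin N) ℂ) (specialUnitaryUnits (Fin N)) R₁ R₂ x).Reg336 c α₀ U →
          givenBy3185stY x (lettersYOfRecordV11K N θ Mstar 𝔯 x) (sectEStYOfRecordV7 N θ Mstar 𝔢₀ x) U ∧ hasRWExpCY (𝔴 x) U δ₁ ∧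
            DecayMidOnStY x (lettersYOfRecordV11K N θ Mstar 𝔯 x) (sectEStYOfRecordV7 N θ Mstar 𝔢₀ x) B₁ U δ₁) :
    B9.Thm315FullPrinted c geo9Y (bg9YR (Matrix (Fin N) (Fin N) ℂ) (specialUnitaryUnits (Fin N)) R₁ R₂)
      (fun x => siteKernelR R₁ R₂ (opsYStOfRecordV11KE N θ Mstar 𝔯 (sectEStYOfRecordV7 N θ Mstar 𝔢₀) 𝔴 𝔈 x).Ck) inΛY unitDistY
      (fun x => (opsYStOfRecordV11KE N θ Mstar 𝔯 (sectEStYOfRecordV7 N θ Mstar 𝔢₀) 𝔴 𝔈 x).GivenBy3185)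
      (fun x => (opsYStOfRecordV11KE N θ Mstar 𝔯 (sectEStYOfRecordV7 N θ Mstar 𝔢₀) 𝔴 𝔈 x).HasRWExpC) :=
  t315_opsYSectESt_sectEStYOfRecordV7_of_3185_onR N θ Mstar 𝔢₀ hGR (opsYS349OfLetters N θ Mstar (lettersYOfRecordV11K N θ Mstar 𝔯) 𝔈)
    (lettersYOfRecordV11K N θ Mstar 𝔯) 𝔴 ha₀ hδ₁ hB₁ h

end RecordKnit

/-! ## §5 ★★★ (3.152) AND (3.124) FOR THE v11 KNIT RECORD'S OWN `G₁` ON THE REGIME OF RECORD, FROM (3.138) ALONE -/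

section Ids3152

open scoped Matrix.Norms.L2Operator

/-- ★★★ **(3.152) `R D* G₁ = R G′ D*`, `G₁ D R = D G′ R` AND (3.124) `Q G₁ D R = 0`, `R D* G₁ Q† = 0`, `R D* G₁ D R = R` FOR THE v11 KNIT RECORD'S OWN
LETTER `G₁ = (lettersYOfRecordV11K N θ Mstar 𝔯 x).G₁`** (print's `Q` of (3.115), its trace adjoint, print's knit transporter, `G′_phys`, the residual
`(𝔯 x).Δ2`) at every background `U` of the regime of record `regQY G x c₀ α₀` (`G ≤ U(N)` unit-bounded, `c₀ ≤ 10`, `0 ≤ Mα₀`, the x-free numerics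
`K_pl(Mα₀)·L⁴ < α₀′`, `C₀α₀′ ≤ 1/3`, `2α₀′ ≤ c₂′`), in print's units `c_f η = 1`, GIVEN ONLY that `G₁⁻¹(U)` is invertible ((3.138), not claimed) —
`Node00.OpsYIds3152ReductionQ.ids3152Q_qKnitOfRecord_of_regQY` read on the record (`lettersYOfRecordV11K_sectDE`, `rfl`).
[cite: Balaban1985BackgroundPropagators, (3.152) p.426, (3.124) p.420, (3.115) p.418, (3.138) p.423, (3.24)–(3.25) p.394, (3.35) p.396] [cite: Balaban1985Averaging, Prop. 2 p.26, (15) p.19] -/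
theorem lettersYOfRecordV11K_ids3152_of_regQY (N : ℕ) [Nonempty (Fin N)] (θ : Stage3Params) (Mstar : ℕ) (𝔯 : ResY N θ Mstar)
    {G : Subgroup (Matrix (Fin N) (Fin N) ℂ)ˣ} (hG1 : ∀ u : (Matrix (Fin N) (Fin N) ℂ)ˣ, u ∈ G → ‖(u : Matrix (Fin N) (Fin N) ℂ)‖ ≤ 1)
    (hGU : G ≤ B7Prop2Explicit.unitaryUnits (Matrix (Fin N) (Fin N) ℂ)) {c₀ α₀ : ℝ} (hc : c₀ ≤ 10) (x : MemberY θ.d₆ θ.ℓ₆ θ.hd' θ.hL' θ.b₀ θ.b₁ Mstar)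
    (hMα : 0 ≤ (kGeo x.toKIdx).M * α₀) {α₀' : ℝ} (hα' : 0 < α₀') (hα3 : C0 (θ.d₆ + 1) * α₀' ≤ 1 / 3) (hα2 : 2 * α₀' ≤ c2' (θ.d₆ + 1) (θ.ℓ₆ + 1))
    (hK : Kpl x.toKIdx ((kGeo x.toKIdx).M * α₀) * (kGeo x.toKIdx).L ^ 4 < α₀') (hcf : x.toKIdx.cf * etaS x.toKIdx = 1)
    {U : CfgY (Matrix (Fin N) (Fin N) ℂ) x.toKIdx} (hU : regQY G x.toKIdx c₀ α₀ U)
    (hM1 : IsUnit (deltaOneQY x.toKIdx (qKnitOfRecord N θ x.toKIdx) (qsKnitOfRecord N θ x.toKIdx) (parKnitY x.toKIdx) (GpPhysY x.toKIdx (parKnitY x.toKIdx))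
      (𝔯 x).Δ2 U)) :
    RY x.toKIdx (parKnitY x.toKIdx) (GpPhysY x.toKIdx (parKnitY x.toKIdx)) U ∘ₗ divY x.toKIdx U ∘ₗ (lettersYOfRecordV11K N θ Mstar 𝔯 x).G₁ U
        = RY x.toKIdx (parKnitY x.toKIdx) (GpPhysY x.toKIdx (parKnitY x.toKIdx)) U ∘ₗ GpPhysY x.toKIdx (parKnitY x.toKIdx) U ∘ₗ divY x.toKIdx U
    ∧ (lettersYOfRecordV11K N θ Mstar 𝔯 x).G₁ U ∘ₗ gradY x.toKIdx U ∘ₗ RY x.toKIdx (parKnitY x.toKIdx) (GpPhysY x.toKIdx (parKnitY x.toKIdx)) U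
        = gradY x.toKIdx U ∘ₗ GpPhysY x.toKIdx (parKnitY x.toKIdx) U ∘ₗ RY x.toKIdx (parKnitY x.toKIdx) (GpPhysY x.toKIdx (parKnitY x.toKIdx)) U
    ∧ qKnitOfRecord N θ x.toKIdx U ∘ₗ (lettersYOfRecordV11K N θ Mstar 𝔯 x).G₁ U ∘ₗ gradY x.toKIdx U ∘ₗ
          RY x.toKIdx (parKnitY x.toKIdx) (GpPhysY x.toKIdx (parKnitY x.toKIdx)) U = 0
    ∧ RY x.toKIdx (parKnitY x.toKIdx) (GpPhysY x.toKIdx (parKnitY x.toKIdx)) U ∘ₗ divY x.toKIdx U ∘ₗ (lettersYOfRecordV11K N θ Mstar 𝔯 x).G₁ U ∘ₗ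
          qsKnitOfRecord N θ x.toKIdx U = 0
    ∧ RY x.toKIdx (parKnitY x.toKIdx) (GpPhysY x.toKIdx (parKnitY x.toKIdx)) U ∘ₗ divY x.toKIdx U ∘ₗ (lettersYOfRecordV11K N θ Mstar 𝔯 x).G₁ U ∘ₗ
          gradY x.toKIdx U ∘ₗ RY x.toKIdx (parKnitY x.toKIdx) (GpPhysY x.toKIdx (parKnitY x.toKIdx)) U
        = RY x.toKIdx (parKnitY x.toKIdx) (GpPhysY x.toKIdx (parKnitY x.toKIdx)) U :=
  ids3152Q_qKnitOfRecord_of_regQY N θ hG1 hGU hc x.toKIdx hMα hα' hα3 hα2 hK hcf (𝔯 x).Δ2 hU hM1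

end Ids3152

end

end Literature.MathematicalPhysics.QuantumFieldTheory.Balaban1983to89.Node00
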